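import Literature.Probability.RandomPlanarGeometry.HexSAWSurfaceDensityFunction
import Literature.Probability.RandomPlanarGeometry.SAWPulledRenewalGap
import Literature.Probability.Process.RenewalGeometricEnvelope
import Literature.Probability.Process.RenewalTheorem
import Literature.Probability.Process.RenewalRate
import HarnessLib

/-!
# The renewal structure of the ADSORBED phase of honeycomb surface walks: positive wall bridges, the weighted
# renewal equation, the entropy lemma `4·visits ≤ n + 2` for irreducible pieces, and — for `y > μ⁴ = 6 + 4√2` —
# the adsorbed Kesten relation, a finite mean block length and pure exponential growth `P_{2s}(y) ∼ β(y)^{2s}/m(y)`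

Topic `Literature/Probability/RandomPlanarGeometry` (lane «pcv-sawmu», a-idea-1 g28, door «ADSORBED-RENEWAL»; parents:
`HexSAWSurfaceDensityFunction.lean` → `HexSAWSurfaceWallBridges.lean` for the wall bridges `wbr n` of the honeycomb half-lattice in the
brick-wall frame (SAWs from `0` in `Y ≤ 0`, `n` even, `Y_n = 0`, `0 ≤ X_i ≤ X_n`), the surface-visit count `visits`, the partition
function `WB n y = Σ_{ω ∈ wbr n} y^{visits}`, the junction `tailPiece`, the growth rate `β(y) = wallRate y` with `WB_le_pow`,
`eventually_mul_pow_le_WB` and `card_wbr_le_pow : #wbr_m ≤ μ^{m+2}`; `SAWBridgeRenewalEquation.lean` (via `SAWPulledRenewalGap`)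
for the bridge / renewal-time calculus on `ℤ^d` (`Zd.IsBridge`, `Zd.IsRenewalTime`, `Zd.concatWalk`, head / tail pieces,
`Zd.concatWalk_injective_pieces`); the MODEL-FREE renewal toolkit `Process/Renewal{Theorem,GeometricEnvelope,Rate}.lean` and
`Zd.renewal_two_sub_tsum_le` of `SAWPulledRenewalGap.lean` (lane R35 «PULL-GAP», the pulled problem)).

THE MECHANISM.  A **positive wall bridge** (`pwb n`) is a wall bridge that is also a bridge in the strict sense of Kesten /
Madras–Slade (`0 = X_0 < X_i ≤ X_n`); a **wall-renewal time** is a renewal time `k` (both `ω[0,k]` and `ω[k,n]` bridges) that is a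
surface visit (`k` even, `Y_k = 0`).  Cutting at a wall-renewal time gives two positive wall bridges and the visits ADD (the cut
point is a visit of the head, the origin of the tail); conversely the concatenation of two positive wall bridges is one, with a
wall-renewal time at the joint (the parity constraint of the vertical brick-wall bonds is translation-invariant under EVEN wall
times).  Hence, exactly as for bridges [MadrasSlade1993, §4.2, eq. (4.2.2) (p. 90)], cutting at the FIRST wall-renewal time is a
bijection and the weighted counts `P_n(y) := Σ_{pwb n} y^{visits}`, `Λ_n(y) := Σ_{irreducible} y^{visits}` satisfy the RENEWAL
EQUATION `P_n = Σ_{1 ≤ s ≤ n} Λ_s P_{n−s}` (`n ≥ 1`), all lengths even.  Normalising by `β(y)^n` (`P_{2s} ≤ β^{2s}` by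
super-multiplicativity, `y·WB_n ≤ P_{n+2}` by appending one junction) gives a renewal pair `u_s = Σ_k f_k u_{s−k}` with
`u_s ≤ 1`, to which the tree's renewal theory applies ONCE TWO INPUTS ARE SUPPLIED: (i) RECURRENCE `Σ f = 1`, (ii) a finite mean
`Σ s f_s < ∞`.  Both come from ONE new combinatorial estimate, the **entropy lemma**: an IRREDUCIBLE positive wall bridge of
length `n` has at most `(n+2)/4` surface visits — the adsorption analogue of "an irreducible bridge of span `L ≥ 2` must have at
least `3L` steps" [MadrasSlade1993, §4.2, remark before (4.2.21) (p. 94)].  (Charging: every interior visit time `t` is left either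
by an on-wall LEFT step, or by a DOWN step, or by a RIGHT step — and in the last case, `t` not being a renewal time, the walk
overhangs column `X_t` before `t` or returns to it after `t`, through an off-wall LEFT step landing on column `X_t`; these charges
are injective, `#up = #down`, and the visits sit at distinct even columns of `(0, X_n]`, `X_n = #right − #left`; so
`4·#visits ≤ n + 2`.)  Consequently `Λ_{2s}(y) ≤ #wbr_{2s} · (√y)^{s+1} ≤ μ^{2s+2} (√y)^{s+1}` and, with `β(y)² ≥ y`,
`f_s(y) ≤ μ²√y · θ(y)^s`, `θ(y) := μ²/√y` — a GEOMETRIC ENVELOPE with ratio `< 1` exactly when `y > μ⁴ = (2+√2)² = 6 + 4√2 ≈ 11.66`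
(`μ = μ(ℍ) = √(2+√2)` [DuminilCopinSmirnov2012, Theorem 1]; `y_c = 1 + √2` [BeatonBousquetMelouDeGierDuminilCopinGuttmann2014,
Theorem 1], so the threshold is `2 y_c²`).  Recurrence then follows from the envelope and the exponential growth of `u_s ρ^s`
(`ρ > 1`; Fekete lower envelope of `WB`) by the tree's persistence lemma `Renewal.hasSum_f_one_of_envelope`
[Feller1968, XIII.3, Theorem 2], the mean is finite by `Renewal.summable_mul_f_of_envelope`, and `f_1 = y/β² > 0` (aperiodicity).

MAIN RESULTS (`y > μ⁴` unless stated; `β = wallRate y`, `m(y) = pwbMean y = Σ_s s f_s(y)`):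
* §1 `PWB_mul_le : P_s P_{n−s} ≤ P_n`, `mul_WB_le_PWB : y·WB_n ≤ P_{n+2}`, `PWB_le_pow : P_{2s} ≤ β^{2s}` (all `y > 0`);
* §2 ★ `PWB_eq_sum_range` / `PWB_two_mul_eq_sum : P_{2s}(y) = Σ_{k ≤ s} Λ_{2k}(y) P_{2s−2k}(y)` (`s ≥ 1`, every real `y`);
* §3 ★★ `four_mul_visits_le : ω ∈ ipwb n → 4 · visits n ω ≤ n + 2` (with the discrete-descent lemma `exists_descent` and the
  charging lemma `exists_left_step_onto`);
* §4 `IPWB_le_pow_mul_sqrt_pow : Λ_{2s}(y) ≤ μ^{2s+2} (√y)^{s+1}` (`y ≥ 1`), `pwbLaw_le_geom : f_s ≤ μ²√y · θ^s`, the normalised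
  renewal equation `pwbAmp_eq_sum` [MadrasSlade1993, §4.2, eq. (4.2.5) (p. 91)];
* §5 ★★ `hasSum_pwbLaw : Σ_s Λ_{2s}(y) β(y)^{−2s} = 1` — the KESTEN RELATION OF THE ADSORBED PHASE
  [MadrasSlade1993, §4.2, eq. (4.2.4) (p. 91); Kesten1963SAW, §4] — and `summable_mul_pwbLaw : m(y) < ∞`;
* §6 ★★ `tendsto_pwbAmp : P_{2s}(y)/β(y)^{2s} → 1/m(y)` — the RENEWAL THEOREM [MadrasSlade1993, §4.2, Theorem 4.2.2(b) (pp. 91–92)]: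
  positive wall bridges of the adsorbed phase grow PURELY exponentially, `P_{2s} ≍ β^{2s}` with no sub-exponential correction;
  `PWB_two_sided : (2 − m) β^{2s} ≤ P_{2s} ≤ β^{2s}` and `two_sub_pwbMean_mul_pow_le_WB : (2 − m) β^{2s} ≤ WB_{2s}` for ALL `s`;
  the explicit geometric RATE `abs_pwbAmp_sub_inv_pwbMean_le : |P_{2s} β^{−2s} − 1/m| ≤ H/(m(1−G)) ρ^{−s}` in `_of` form (the two
  generating-function values `G < 1`, `H` of the tail sums at a radius `ρ ≥ 1` are the finite data) [Feller1968, Ch. XIII §11];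
  `eventually_mul_pow_le_WB_of_lt_inv_pwbMean` (every `c < 1/m`: eventually `c β^{2s} ≤ P_{2s} ≤ WB_{2s}`, sharpening the parent's
  Fekete envelope `r < β` to the rate `β` itself); the RATIO LIMIT `tendsto_PWB_ratio : P_{2s+2}/P_{2s} → β²`; and the explicit
  mean bound `pwbMean_le : m(y) ≤ 1 + μ⁴ θ/(1−θ)²`, so that the all-`s` constant `2 − m(y)` is positive once `μ⁴ θ < (1−θ)²`.

HONEST LABEL.  LANE THEOREM (the renewal structure of Kesten / Madras–Slade §4.2 transported to SURFACE-WEIGHTED wall bridges of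
the honeycomb half-lattice, plus one elementary counting lemma); NEW IN WRITING (modest): the weighted renewal equation with its
Kesten relation `Σ Λ_{2s} β^{−2s} = 1`, finite mean block length and pure exponential order of wall-bridge partition functions in
the explicit adsorbed regime `y > 2y_c² = 6 + 4√2`, and the entropy lemma `4·visits ≤ n + 2` for irreducible pieces.  In-tree
neighbours and the delta: `SAWAdsorptionIrreducibleBridges.lean` (wall-returning `x`-bridges of `ℤ²₊`: the renewal INEQUALITY and a
certificate principle — no equality, no recurrence, no limit), `SAWPulledRenewalGap.lean` (the same model-free toolkit for the
PULLED endpoint weight `e^{f h}` on `ℤ^d`), `SAWKestenRelation.lean` / `HexSAWBrickWallKestenRelation.lean` (bulk Kesten relations,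
no surface weight), `SAWIrreducibleBridgeRatioLimit.lean` (bulk `λ_{N+2}/λ_N → μ²`).  Nearest use in print of the renewal structure of honeycomb
bridges: [BeatonBousquetMelouDeGierDuminilCopinGuttmann2014, Appendix (proof of Theorem 10)] — the UNWEIGHTED Kesten relation
`Σ_{γ ∈ iSAB} x_c^{|γ|} = 1` for (vertical) bridges at `y = 1` and the renewal measure it defines; the surface-weighted wall-bridge
version of the present file is not treated there.  Sources of the ingredients AS PRINTED: bridges
and their super-multiplicativity [MadrasSlade1993, Definition 1.2.4, (1.2.15)–(1.2.17) (p. 11)], irreducible bridges, the renewal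
equation and the renewal theorem [MadrasSlade1993, §4.2, Definition 4.2.1, eqs. (4.2.2), (4.2.4), (4.2.5), Theorem 4.2.2 (pp. 90–92)],
[Kesten1963SAW, §4], [Feller1968, XIII.3 and Ch. XIII §11]; surface bridges and their concatenation [HammersleyTorrieWhittington1982,
§2]; the surface-visit weights of the honeycomb half-lattice [BeatonBousquetMelouDeGierDuminilCopinGuttmann2014, §3.1 (arXiv v5
pp. 8–9)]; the brick-wall frame [EntingJensen2009, §7.4.2, Fig. 7.10].  NOT claimed: anything for `y ≤ μ⁴` (in particular near
`y_c = 1 + √2`, where `θ ≥ 1` and recurrence of the wall-renewal process is open here), `m(y) < 2` for moderate `y` (the crude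
envelope constant gives it only for `μ⁴θ < (1−θ)²`), a renewal theorem for ALL wall bridges `WB` (a delayed renewal, not treated:
only the lower transfer `P ≤ WB` is), the values of the first irreducible counts, numerics.
-/

noncomputable section

open Finset Filter Function
open Literature.Probability.LatticeModels Literature.Probability.Percolation SimpleGraph
open Literature.Combinatorics.Enumerative
open _root_.Topology

namespace Literature.Probability.RandomPlanarGeometry.SAW.HexBW.Wall

variable {n : ℕ} {ω : ℕ → Site 2} {y : ℝ}

/-! ### §0 Positive wall bridges, wall-renewal times, irreducible pieces and their weights -/

open Classical in
/-- **Positive wall bridges**: wall bridges (`wbr n`: brick-wall SAWs from `0` in `Y ≤ 0`, `n` even, `Y_n = 0`,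
`0 ≤ X_i ≤ X_n`) which are moreover bridges in the strict-start sense of Kesten / Madras–Slade, `X_0 < X_i ≤ X_n` for
`1 ≤ i ≤ n`. [cite: MadrasSlade1993, Definition 1.2.4 and §4.2; HammersleyTorrieWhittington1982, §2 (surface bridges)] -/
def pwb (n : ℕ) : Finset (ℕ → Site 2) := (wbr n).filter (Zd.IsBridge n)

/-- **Wall-renewal time** `k` of `ω[0,n]`: a renewal time in the sense of Madras–Slade (`ω[0,k]` and `ω[k,n]` are
bridges) which is moreover a surface visit (`k` even, `Y_k = 0`), so that both pieces are again positive wall bridges.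
[cite: MadrasSlade1993, §4.2, Definition 4.2.1; HammersleyTorrieWhittington1982, §2] -/
def IsWRen (n : ℕ) (ω : ℕ → Site 2) (k : ℕ) : Prop := Zd.IsRenewalTime n ω k ∧ k % 2 = 0 ∧ ω k 1 = 0

open Classical in
/-- **Irreducible positive wall bridges**: `n ≥ 1` and no wall-renewal time in `[1, n)`.
[cite: MadrasSlade1993, §4.2, Definition 4.2.1 (irreducible bridges)] -/
def ipwb (n : ℕ) : Finset (ℕ → Site 2) :=
  (pwb n).filter fun ω => 1 ≤ n ∧ ∀ k, 1 ≤ k → k < n → ¬ IsWRen n ω k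

/-- `P_n(y) = Σ_{positive wall bridges} y^{#visits}`. [cite: HammersleyTorrieWhittington1982, §2; MadrasSlade1993, §4.2, (4.2.2)] -/
def PWB (n : ℕ) (y : ℝ) : ℝ := ∑ ω ∈ pwb n, y ^ visits n ω

/-- `Λ_n(y) = Σ_{irreducible positive wall bridges} y^{#visits}`. [cite: MadrasSlade1993, §4.2, (4.2.2)] -/
def IPWB (n : ℕ) (y : ℝ) : ℝ := ∑ ω ∈ ipwb n, y ^ visits n ω

/-- Membership in `pwb`. [cite: MadrasSlade1993, Definition 1.2.4] -/
theorem mem_pwb : ω ∈ pwb n ↔ ω ∈ wbr n ∧ Zd.IsBridge n ω := by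
  classical
  exact Finset.mem_filter

/-- Membership in `ipwb`. [cite: MadrasSlade1993, §4.2, Definition 4.2.1] -/
theorem mem_ipwb : ω ∈ ipwb n ↔ ω ∈ pwb n ∧ 1 ≤ n ∧ ∀ k, 1 ≤ k → k < n → ¬ IsWRen n ω k := by
  classical
  simp only [ipwb, Finset.mem_filter]

/-- `pwb n ⊆ wbr n`. [cite: MadrasSlade1993, Definition 1.2.4] -/
theorem pwb_subset : pwb n ⊆ wbr n := fun _ h => (mem_pwb.1 h).1

/-- `ipwb n ⊆ pwb n`. [cite: MadrasSlade1993, §4.2, Definition 4.2.1] -/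
theorem ipwb_subset : ipwb n ⊆ pwb n := fun _ h => (mem_ipwb.1 h).1

/-- A positive wall bridge is a brick-wall SAW. [cite: MadrasSlade1993, Definition 1.2.4] -/
theorem saws_of_mem_pwb (h : ω ∈ pwb n) : ω ∈ saws n := hpw_subset (archs_subset (wbr_subset (pwb_subset h)))

/-- A positive wall bridge is a bridge on `ℤ²` in the sense of Madras–Slade. [cite: MadrasSlade1993, Definition 1.2.4] -/
theorem zd_bridges_of_mem_pwb (h : ω ∈ pwb n) : ω ∈ Zd.bridges 2 n :=
  Zd.mem_bridges.2 ⟨saws_subset _ (saws_of_mem_pwb h), (mem_pwb.1 h).2⟩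

/-- `P_n(y) ≥ 0`. [cite: HammersleyTorrieWhittington1982, §2] -/
theorem PWB_nonneg (n : ℕ) (hy : 0 ≤ y) : 0 ≤ PWB n y := Finset.sum_nonneg fun _ _ => pow_nonneg hy _

/-- `Λ_n(y) ≥ 0`. [cite: MadrasSlade1993, §4.2] -/
theorem IPWB_nonneg (n : ℕ) (hy : 0 ≤ y) : 0 ≤ IPWB n y := Finset.sum_nonneg fun _ _ => pow_nonneg hy _

/-- `P_n(y) ≤ B^w_n(y)`. [cite: HammersleyTorrieWhittington1982, §2] -/
theorem PWB_le_WB (n : ℕ) (hy : 0 ≤ y) : PWB n y ≤ WB n y :=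
  Finset.sum_le_sum_of_subset_of_nonneg pwb_subset fun _ _ _ => pow_nonneg hy _

/-- `Λ_n(y) ≤ P_n(y)`. [cite: MadrasSlade1993, §4.2, (4.2.3)] -/
theorem IPWB_le_PWB (n : ℕ) (hy : 0 ≤ y) : IPWB n y ≤ PWB n y :=
  Finset.sum_le_sum_of_subset_of_nonneg ipwb_subset fun _ _ _ => pow_nonneg hy _

/-- No positive wall bridges of odd length. [cite: BeatonBousquetMelouDeGierDuminilCopinGuttmann2014, §3.1 (arXiv v5 p. 9)] -/
theorem pwb_eq_empty_of_odd (hn : n % 2 = 1) : pwb n = ∅ := by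
  rw [← Finset.subset_empty, ← wbr_eq_empty_of_odd hn]; exact pwb_subset

/-- `P_n(y) = 0` for `n` odd. [cite: BeatonBousquetMelouDeGierDuminilCopinGuttmann2014, §3.1 (arXiv v5 p. 9)] -/
theorem PWB_eq_zero_of_odd (hn : n % 2 = 1) (y : ℝ) : PWB n y = 0 := by
  rw [PWB, pwb_eq_empty_of_odd hn, Finset.sum_empty]

/-- No irreducible positive wall bridges of odd length. [cite: BeatonBousquetMelouDeGierDuminilCopinGuttmann2014, §3.1 (arXiv v5 p. 9)] -/
theorem ipwb_eq_empty_of_odd (hn : n % 2 = 1) : ipwb n = ∅ :=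
  Finset.subset_empty.1 (ipwb_subset.trans (pwb_eq_empty_of_odd hn).subset)

/-- `Λ_n(y) = 0` for `n` odd. [cite: BeatonBousquetMelouDeGierDuminilCopinGuttmann2014, §3.1 (arXiv v5 p. 9)] -/
theorem IPWB_eq_zero_of_odd (hn : n % 2 = 1) (y : ℝ) : IPWB n y = 0 := by
  rw [IPWB, ipwb_eq_empty_of_odd hn, Finset.sum_empty]

/-- `ipwb 0 = ∅` and so `Λ_0(y) = 0`. [cite: MadrasSlade1993, §4.2 (`λ_0 = 0`)] -/
theorem IPWB_zero (y : ℝ) : IPWB 0 y = 0 := by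
  have : ipwb 0 = ∅ := Finset.eq_empty_of_forall_notMem fun ω h => by
    have := (mem_ipwb.1 h).2.1; omega
  rw [IPWB, this, Finset.sum_empty]

/-- The `0`-step walk: `pwb 0 = wbr 0 = {0}`, so `P_0(y) = 1`. [cite: MadrasSlade1993, §1.2 (`b_0 = 1`)] -/
theorem PWB_zero (y : ℝ) : PWB 0 y = 1 := by
  have h1 : pwb 0 = wbr 0 :=
    Finset.ext fun ω => by rw [mem_pwb]; exact ⟨fun h => h.1, fun h => ⟨h, Zd.isBridge_zero ω⟩⟩
  have h2 : wbr 0 = {Zd.straightWalk 2 0} := by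
    refine Finset.eq_singleton_iff_unique_mem.2 ⟨by simpa using straightWalk_mem_wbr 0, fun ω hω => ?_⟩
    obtain ⟨h0, hend, -, -⟩ := mem_saws_iff.1 (hpw_subset (archs_subset (wbr_subset hω)))
    funext i
    rw [hend i (Nat.zero_le i), h0]
    simp [Zd.straightWalk]
  rw [PWB, h1, h2, Finset.sum_singleton, visits_zero, pow_zero]

/-- The straight walk `0 → e₀ → ⋯ → 2j·e₀` along the surface is a positive wall bridge with `j` visits.
[cite: BeatonBousquetMelouDeGierDuminilCopinGuttmann2014, §3.1 (arXiv v5 p. 9: walks sticking to the surface)] -/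
theorem straightWalk_mem_pwb (j : ℕ) :
    Zd.straightWalk 2 (2 * j) ∈ pwb (2 * j) ∧ visits (2 * j) (Zd.straightWalk 2 (2 * j)) = j := by
  refine ⟨mem_pwb.2 ⟨straightWalk_mem_wbr j, fun i h1 h2 => ?_⟩, ?_⟩
  · simp only [straightWalk_apply_zero]; constructor <;> push_cast <;> omega
  · suffices h : ∀ m ≤ 2 * j, visits m (Zd.straightWalk 2 (2 * j)) = m / 2 by rw [h _ le_rfl]; omega
    intro m hm
    induction m with
    | zero => simp
    | succ m ih =>
      rw [visits_succ, ih (by omega), straightWalk_apply_one]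
      split_ifs with h <;> omega

/-- `y^j ≤ P_{2j}(y)`, in particular `P_{2j}(y) > 0` for `y > 0`. [cite: HammersleyTorrieWhittington1982, §2] -/
theorem pow_le_PWB (hy : 0 ≤ y) (j : ℕ) : y ^ j ≤ PWB (2 * j) y := by
  obtain ⟨h1, h2⟩ := straightWalk_mem_pwb j
  calc y ^ j = y ^ visits (2 * j) (Zd.straightWalk 2 (2 * j)) := by rw [h2]
    _ ≤ PWB (2 * j) y := Finset.single_le_sum (fun _ _ => pow_nonneg hy _) h1

/-- `P_{2j}(y) > 0` for `y > 0`. [cite: HammersleyTorrieWhittington1982, §2] -/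
theorem PWB_pos (hy : 0 < y) (j : ℕ) : 0 < PWB (2 * j) y := (pow_pos hy j).trans_le (pow_le_PWB hy.le j)

/-- A bridge in the strict-start sense is a wall bridge in the weak sense (`X_0 ≤ X_i ≤ X_n`). [cite: MadrasSlade1993, Definition 1.2.4] -/
theorem isWB_of_isBridge (h : Zd.IsBridge n ω) : IsWB n ω := by
  intro i hi
  rcases Nat.eq_zero_or_pos i with rfl | hi0
  · rcases Nat.eq_zero_or_pos n with rfl | hn0
    · exact ⟨le_rfl, le_rfl⟩
    · exact ⟨le_rfl, (h n hn0 le_rfl).1.le⟩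
  · exact ⟨(h i hi0 hi).1.le, (h i hi0 hi).2⟩

/-! ### §1 Gluing and cutting positive wall bridges at wall-renewal times -/

/-- **Gluing**: an `s`-step positive wall bridge followed by (the translate of) an `(n-s)`-step one is an `n`-step
positive wall bridge, the visits add, and the gluing time `s` is a wall-renewal time. [cite: MadrasSlade1993, §1.2, (1.2.15) and §4.2, (4.2.2); HammersleyTorrieWhittington1982, §2] -/
theorem concat_mem_pwb {s : ℕ} {η τ : ℕ → Site 2} (hsn : s ≤ n) (hη : η ∈ pwb s) (hτ : τ ∈ pwb (n - s)) :
    Zd.concatWalk s η τ ∈ pwb n ∧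
      visits n (Zd.concatWalk s η τ) = visits s η + visits (n - s) τ ∧ IsWRen n (Zd.concatWalk s η τ) s := by
  have hηw := pwb_subset hη
  have hτw := pwb_subset hτ
  obtain ⟨hηa, -⟩ := mem_wbr.1 hηw
  obtain ⟨hηh, hs2, hηend⟩ := mem_archs.1 hηa
  obtain ⟨hηs, hηhp⟩ := mem_hpw.1 hηh
  obtain ⟨hτa, -⟩ := mem_wbr.1 hτw
  obtain ⟨hτh, hns2, hτend⟩ := mem_archs.1 hτa
  obtain ⟨hτs, hτhp⟩ := mem_hpw.1 hτh
  obtain ⟨hτ0, -, hτbw, -⟩ := mem_saws_iff.1 hτs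
  obtain ⟨-, -, hηbw, -⟩ := mem_saws_iff.1 hηs
  have hzb := Zd.concatWalk_mem_bridges hsn (zd_bridges_of_mem_pwb hη) (zd_bridges_of_mem_pwb hτ)
  obtain ⟨hzs, hbr⟩ := Zd.mem_bridges.1 hzb
  have hpar : (η s 0 + η s 1) % 2 = 0 := by
    have := parity_apply hηs le_rfl; rw [this]; exact_mod_cast hs2
  have hbw : IsBW n (Zd.concatWalk s η τ) := by
    have := isBW_concatWalk hηbw hτbw hτ0 hpar
    rwa [Nat.add_sub_cancel' hsn] at this
  have hval1 : ∀ j, Zd.concatWalk s η τ (s + j) 1 = τ j 1 := fun j => by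
    rw [Zd.concatWalk_apply_add η τ hτ0 j, Pi.add_apply, hηend, zero_add]
  have hvis : visits n (Zd.concatWalk s η τ) = visits s η + visits (n - s) τ := by
    have h := visits_add (ζ := Zd.concatWalk s η τ) (ξ := τ) (b := n - s) hs2 (fun j _ _ => hval1 j)
    rw [Nat.add_sub_cancel' hsn] at h
    rw [h, visits_congr (fun i _ hi => by rw [Zd.concatWalk_apply_of_le η τ hi])]
  refine ⟨mem_pwb.2 ⟨mem_wbr.2 ⟨mem_archs.2 ⟨mem_hpw.2 ⟨mem_saws.2 ⟨hzs, hbw⟩, fun i hi => ?_⟩, ?_, ?_⟩,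
    isWB_of_isBridge hbr⟩, hbr⟩, hvis, Zd.isRenewalTime_concatWalk hsn (zd_bridges_of_mem_pwb hη)
      (zd_bridges_of_mem_pwb hτ), hs2, by rw [Zd.concatWalk_apply_of_le η τ le_rfl]; exact hηend⟩
  · rcases le_or_gt i s with his | his
    · rw [Zd.concatWalk_apply_of_le η τ his]; exact hηhp i his
    · obtain ⟨j, rfl⟩ : ∃ j, i = s + j := ⟨i - s, by omega⟩
      rw [hval1 j]; exact hτhp j (by omega)
  · omega
  · have := hval1 (n - s)
    rw [Nat.add_sub_cancel' hsn] at this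
    rw [this]; exact hτend

/-- **Cutting, head**: the head `i ↦ ω (min i s)` of a positive wall bridge at a wall-renewal time `s` is an
`s`-step positive wall bridge with the visits of `ω` up to time `s`. [cite: MadrasSlade1993, §4.2, (4.2.2)] -/
theorem head_mem_pwb {s : ℕ} (hω : ω ∈ pwb n) (hs : IsWRen n ω s) :
    (fun i => ω (min i s)) ∈ pwb s ∧ visits s (fun i => ω (min i s)) = visits s ω := by
  obtain ⟨hren, hs2, hY⟩ := hs
  have hsn := hren.1
  have hω' := pwb_subset hω
  have hh := mem_hpw.2 ⟨saws_of_mem_pwb hω, (mem_hpw.1 (archs_subset (wbr_subset hω'))).2⟩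
  obtain ⟨ha, hv⟩ := prefixWalk_mem_archs hh hsn hs2 hY
  have hb : Zd.IsBridge s (fun i => ω (min i s)) := hren.2.1.congr fun i hi => by simp only [min_eq_left hi]
  exact ⟨mem_pwb.2 ⟨mem_wbr.2 ⟨ha, isWB_of_isBridge hb⟩, hb⟩, hv⟩

/-- **Cutting, tail**: the re-based tail `j ↦ ω (s + j) − ω s` after a wall-renewal time `s` is an `(n-s)`-step
positive wall bridge, and `visits n ω = visits s ω + visits (n-s) (tail)`. [cite: MadrasSlade1993, §4.2, (4.2.2)] -/
theorem tail_mem_pwb {s : ℕ} (hω : ω ∈ pwb n) (hs : IsWRen n ω s) :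
    (fun j => ω (s + j) - ω s) ∈ pwb (n - s) ∧
      visits n ω = visits s ω + visits (n - s) (fun j => ω (s + j) - ω s) := by
  obtain ⟨hren, hs2, hY⟩ := hs
  have hsn := hren.1
  have hω' := pwb_subset hω
  obtain ⟨hωa, -⟩ := mem_wbr.1 hω'
  obtain ⟨hωh, hn2, hend0⟩ := mem_archs.1 hωa
  obtain ⟨hωs, hhp⟩ := mem_hpw.1 hωh
  obtain ⟨h0, hend, hbw, -⟩ := mem_saws_iff.1 hωs
  have htb := Zd.tailShift_mem_bridges (zd_bridges_of_mem_pwb hω) hren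
  obtain ⟨hts, htbr⟩ := Zd.mem_bridges.1 htb
  have hpar : ((-ω s) 0 + (-ω s) 1) % 2 = 0 := by
    have := parity_apply hωs hsn; simp only [Pi.neg_apply]; omega
  have hbw' : IsBW (n - s) (fun j => ω (s + j) - ω s) := by
    intro i hi
    simp only [sub_eq_add_neg]
    rw [show s + (i + 1) = s + i + 1 by omega, adj_add_iff_of_even hpar]
    exact hbw (s + i) (by omega)
  have hvis : visits n ω = visits s ω + visits (n - s) (fun j => ω (s + j) - ω s) := by
    have h := visits_add (ζ := ω) (ξ := fun j => ω (s + j) - ω s) (b := n - s) hs2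
      (fun j _ _ => by simp only [Pi.sub_apply, hY, sub_zero])
    rwa [Nat.add_sub_cancel' hsn] at h
  refine ⟨mem_pwb.2 ⟨mem_wbr.2 ⟨mem_archs.2 ⟨mem_hpw.2 ⟨mem_saws.2 ⟨hts, hbw'⟩, fun i hi => ?_⟩, ?_, ?_⟩,
    isWB_of_isBridge htbr⟩, htbr⟩, hvis⟩
  · simp only [Pi.sub_apply, hY, sub_zero]; exact hhp (s + i) (by omega)
  · omega
  · simp only [Pi.sub_apply, hY, sub_zero]; rw [Nat.add_sub_cancel' hsn]; exact hend0

/-- The head of a positive wall bridge up to its FIRST wall-renewal time `s` is irreducible: an earlier wall-renewal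
time of the head would be one of the whole bridge (`IsRenewalTime.trans`). [cite: MadrasSlade1993, §4.2, (4.2.2)] -/
theorem head_mem_ipwb {s : ℕ} (hω : ω ∈ pwb n) (hs1 : 1 ≤ s) (hs : IsWRen n ω s)
    (hmin : ∀ k, 1 ≤ k → k < s → ¬ IsWRen n ω k) : (fun i => ω (min i s)) ∈ ipwb s := by
  refine mem_ipwb.2 ⟨(head_mem_pwb hω hs).1, hs1, fun k hk1 hk2 hk => hmin k hk1 hk2 ?_⟩
  have he : ∀ i ≤ s, (fun i => ω (min i s)) i 0 = ω i 0 := fun i hi => by simp only [min_eq_left hi]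
  have h3 := hk.2.2
  simp only [min_eq_left hk2.le] at h3
  exact ⟨(hk.1.congr he).trans hs.1, hk.2.1, h3⟩

/-- A positive wall bridge with `n ≥ 1` has a FIRST wall-renewal time `s ∈ [1, n]` (`n` itself is one).
[cite: MadrasSlade1993, §4.2, proof of (4.2.2)] -/
theorem exists_first_wren (hn : 1 ≤ n) (hω : ω ∈ pwb n) :
    ∃ s, 1 ≤ s ∧ IsWRen n ω s ∧ ∀ k, 1 ≤ k → k < s → ¬ IsWRen n ω k := by
  classical
  obtain ⟨hw, hb⟩ := mem_pwb.1 hω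
  obtain ⟨ha, -⟩ := mem_wbr.1 hw
  obtain ⟨-, hn2, hY⟩ := mem_archs.1 ha
  have hex : ∃ s, 1 ≤ s ∧ IsWRen n ω s := ⟨n, hn, Zd.isRenewalTime_self hb, hn2, hY⟩
  exact ⟨Nat.find hex, (Nat.find_spec hex).1, (Nat.find_spec hex).2,
    fun k hk1 hk2 hk => Nat.find_min hex hk2 ⟨hk1, hk⟩⟩

/-- If the first piece is irreducible, the gluing time is the FIRST wall-renewal time of the glued bridge.
[cite: MadrasSlade1993, §4.2, (4.2.2)] -/
theorem not_isWRen_concat_of_lt {s k : ℕ} {η τ : ℕ → Site 2} (hsn : s ≤ n) (hη : η ∈ ipwb s)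
    (hk1 : 1 ≤ k) (hks : k < s) : ¬ IsWRen n (Zd.concatWalk s η τ) k := by
  intro hk
  obtain ⟨hηp, -, hirr⟩ := mem_ipwb.1 hη
  have hb : Zd.IsBridge s (Zd.concatWalk s η τ) := Zd.isBridge_concatWalk_left.2 (mem_pwb.1 hηp).2
  have h1 : Zd.IsRenewalTime s (Zd.concatWalk s η τ) k := hk.1.of_le hks.le hsn hb
  have h2 : Zd.IsRenewalTime s η k := h1.congr fun i hi => by rw [Zd.concatWalk_apply_of_le η τ hi]
  have h3 := hk.2.2
  rw [Zd.concatWalk_apply_of_le η τ hks.le] at h3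
  exact hirr k hk1 hks ⟨h2, hk.2.1, h3⟩

/-! ### §1b Exact supermultiplicativity and the Fekete normalisation `P_{2s}(y) ≤ β(y)^{2s}` -/

/-- **Exact supermultiplicativity of positive wall bridges**: `P_s(y) · P_{n-s}(y) ≤ P_n(y)` (plain concatenation;
no junction is needed because the second piece starts strictly to the right). [cite: MadrasSlade1993, §1.2, (1.2.15)–(1.2.17); HammersleyTorrieWhittington1982, §2] -/
theorem PWB_mul_le {s : ℕ} (hsn : s ≤ n) (hy : 0 ≤ y) : PWB s y * PWB (n - s) y ≤ PWB n y := by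
  classical
  have hinj : Set.InjOn (fun p : (ℕ → Site 2) × (ℕ → Site 2) => Zd.concatWalk s p.1 p.2)
      ↑(pwb s ×ˢ pwb (n - s)) := by
    rintro ⟨η, τ⟩ hp ⟨η', τ'⟩ hp' h
    rw [Finset.mem_coe, Finset.mem_product] at hp hp'
    dsimp only at h
    obtain ⟨h1, h2⟩ := Zd.concatWalk_injective_pieces (saws_subset _ (saws_of_mem_pwb hp.1))
      (saws_subset _ (saws_of_mem_pwb hp.2)) (saws_subset _ (saws_of_mem_pwb hp'.1))
      (saws_subset _ (saws_of_mem_pwb hp'.2)) h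
    simp only [Prod.mk.injEq]
    exact ⟨h1, h2⟩
  calc PWB s y * PWB (n - s) y
      = ∑ η ∈ pwb s, ∑ τ ∈ pwb (n - s), y ^ visits s η * y ^ visits (n - s) τ := by
        rw [PWB, PWB, Finset.sum_mul_sum]
    _ = ∑ p ∈ pwb s ×ˢ pwb (n - s), y ^ visits n (Zd.concatWalk s p.1 p.2) := by
        rw [Finset.sum_product]
        refine Finset.sum_congr rfl fun η hη => Finset.sum_congr rfl fun τ hτ => ?_
        rw [(concat_mem_pwb hsn hη hτ).2.1, pow_add]
    _ = ∑ ζ ∈ (pwb s ×ˢ pwb (n - s)).image (fun p => Zd.concatWalk s p.1 p.2), y ^ visits n ζ :=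
        (Finset.sum_image (f := fun ζ => y ^ visits n ζ) hinj).symm
    _ ≤ PWB n y := by
        refine Finset.sum_le_sum_of_subset_of_nonneg (fun ζ hζ => ?_) fun _ _ _ => pow_nonneg hy _
        obtain ⟨p, hp, rfl⟩ := Finset.mem_image.1 hζ
        rw [Finset.mem_product] at hp
        exact (concat_mem_pwb hsn hp.1 hp.2).1

/-- **Exact supermultiplicativity**, additive form: `P_m(y) · P_k(y) ≤ P_{m+k}(y)`. [cite: MadrasSlade1993, §1.2, (1.2.17)] -/
theorem PWB_mul_PWB_le (m k : ℕ) (hy : 0 ≤ y) : PWB m y * PWB k y ≤ PWB (m + k) y := by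
  have h := PWB_mul_le (n := m + k) (s := m) (Nat.le_add_right m k) hy
  rwa [Nat.add_sub_cancel_left] at h

/-- The tail piece `0 → e₀ → 2e₀` followed by a wall bridge `υ` is a positive wall bridge with one more visit.
[cite: HammersleyTorrieWhittington1982, §2 (concatenation of surface bridges)] -/
theorem tailPiece_mem_pwb {υ : ℕ → Site 2} (hυ : υ ∈ wbr n) (hn : n % 2 = 0) :
    tailPiece υ ∈ pwb (2 + n) ∧ visits (2 + n) (tailPiece υ) = visits n υ + 1 := by
  obtain ⟨hs, hhp, hX1, hX, hYend, hv⟩ := tailPiece_spec hυ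
  have h00 : tailPiece υ 0 0 = 0 := by rw [tailPiece_apply_zero_of_le υ (Nat.zero_le 2)]; simp
  refine ⟨mem_pwb.2 ⟨mem_wbr.2 ⟨mem_archs.2 ⟨mem_hpw.2 ⟨hs, hhp⟩, by omega, hYend⟩, fun i hi => ?_⟩,
    fun i h1 h2 => ?_⟩, hv⟩
  · rw [h00]; exact hX i hi
  · rw [h00]
    have := hX1 i h1 h2
    exact ⟨by omega, (hX i h2).2⟩

/-- **`y · B^w_n(y) ≤ P_{n+2}(y)`**: prefixing the junction `0 → e₀ → 2e₀` turns every wall bridge into a positive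
one with one more visit. [cite: HammersleyTorrieWhittington1982, §2 (concatenation of surface bridges)] -/
theorem mul_WB_le_PWB (n : ℕ) (hy : 0 ≤ y) : y * WB n y ≤ PWB (2 + n) y := by
  classical
  rcases Nat.mod_two_eq_zero_or_one n with hn | hn
  · have hinj : Set.InjOn tailPiece ↑(wbr n) := fun υ hυ υ' hυ' h =>
      tailPiece_injective (mem_saws_iff.1 (hpw_subset (archs_subset (wbr_subset hυ)))).1
        (mem_saws_iff.1 (hpw_subset (archs_subset (wbr_subset hυ')))).1 h
    calc y * WB n y = ∑ υ ∈ wbr n, y ^ (visits n υ + 1) := by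
          rw [WB, Finset.mul_sum]
          exact Finset.sum_congr rfl fun υ _ => by ring
      _ = ∑ υ ∈ wbr n, y ^ visits (2 + n) (tailPiece υ) :=
          Finset.sum_congr rfl fun υ hυ => by rw [(tailPiece_mem_pwb hυ hn).2]
      _ = ∑ ζ ∈ (wbr n).image tailPiece, y ^ visits (2 + n) ζ :=
          (Finset.sum_image (f := fun ζ => y ^ visits (2 + n) ζ) hinj).symm
      _ ≤ PWB (2 + n) y := by
          refine Finset.sum_le_sum_of_subset_of_nonneg (fun ζ hζ => ?_) fun _ _ _ => pow_nonneg hy _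
          obtain ⟨υ, hυ, rfl⟩ := Finset.mem_image.1 hζ
          exact (tailPiece_mem_pwb hυ hn).1
  · rw [WB_eq_zero_of_odd hn y, mul_zero]; exact PWB_nonneg _ hy

/-- Iterated supermultiplicativity: `P_{2s}(y)^k ≤ P_{2sk}(y)`. [cite: MadrasSlade1993, §1.2, (1.2.17)] -/
theorem PWB_pow_le (hy : 0 ≤ y) (s k : ℕ) : PWB (2 * s) y ^ k ≤ PWB (2 * s * k) y := by
  induction k with
  | zero => simp [PWB_zero]
  | succ k ih =>
    calc PWB (2 * s) y ^ (k + 1) = PWB (2 * s) y ^ k * PWB (2 * s) y := pow_succ _ _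
      _ ≤ PWB (2 * s * k) y * PWB (2 * s) y := mul_le_mul_of_nonneg_right ih (PWB_nonneg _ hy)
      _ ≤ PWB (2 * s * k + 2 * s) y := PWB_mul_PWB_le _ _ hy
      _ = PWB (2 * s * (k + 1)) y := by rw [show 2 * s * k + 2 * s = 2 * s * (k + 1) by ring]

/-- **The Fekete normalisation without a second Fekete lemma**: `P_{2s}(y) ≤ β(y)^{2s}` for every `s` (if some
`P_{2s} > β^{2s}`, iterated supermultiplicativity would beat the tree's `B^w_m ≤ (β²/y) β^m`).
[cite: MadrasSlade1993, §1.2, Lemma 1.2.2 and (1.2.17); HammersleyTorrieWhittington1982, §2] -/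
theorem PWB_le_pow (hy : 0 < y) (s : ℕ) : PWB (2 * s) y ≤ wallRate y ^ (2 * s) := by
  by_contra hlt
  rw [not_le] at hlt
  have hB : 0 < wallRate y ^ (2 * s) := pow_pos (wallRate_pos y) _
  set q := PWB (2 * s) y / wallRate y ^ (2 * s) with hq
  have hq1 : 1 < q := (one_lt_div hB).2 hlt
  have hbound : ∀ k : ℕ, q ^ k ≤ wallRate y ^ 2 / y := fun k => by
    have h1 : PWB (2 * s) y ^ k ≤ PWB (2 * s * k) y := PWB_pow_le hy.le s k
    have h2 : PWB (2 * s * k) y ≤ wallRate y ^ 2 / y * wallRate y ^ (2 * s * k) :=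
      (PWB_le_WB _ hy.le).trans (WB_le_pow hy _)
    rw [hq, div_pow, div_le_iff₀ (pow_pos hB k), ← pow_mul]
    exact h1.trans h2
  obtain ⟨k, hk⟩ := ((tendsto_pow_atTop_atTop_of_one_lt hq1).eventually
    (eventually_gt_atTop (wallRate y ^ 2 / y))).exists
  exact absurd (hbound k) (not_le.2 hk)

/-- `y ≤ β(y)²` via `y^s ≤ P_{2s}(y) ≤ β(y)^{2s}` (private twin of the sibling `HexSAWSurfaceWallPotential.le_wallRate_sq`,
kept private so that both modules can be imported together).
[cite: HammersleyTorrieWhittington1982, §2 (β(y) ≥ √y: walks sticking to the surface)] -/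
private theorem le_sq_wallRate_wren (hy : 0 < y) : y ≤ wallRate y ^ 2 :=
  le_trans (by rw [pow_one]) ((pow_le_PWB hy.le 1).trans (PWB_le_pow hy 1))

/-! ### §2 The weighted renewal equation `P_n(y) = Σ_{s=1}^{n} Λ_s(y) P_{n-s}(y)` -/

/-- **The weighted renewal equation of positive wall bridges** (Madras–Slade (4.2.2) with surface weights): for
`n ≥ 1`, `P_n(y) = Σ_{s ≤ n} Λ_s(y) · P_{n-s}(y)` (`Λ_0 = 0`) — every positive wall bridge is, in exactly one way, an
irreducible one (up to its first wall-renewal time `s`) followed by a positive wall bridge, and the visits add because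
the cut is itself a visit. [cite: MadrasSlade1993, §4.2, eq. (4.2.2) (p. 90); Kesten1963SAW, §4] -/
theorem PWB_eq_sum_range (hn : 1 ≤ n) (y : ℝ) :
    PWB n y = ∑ s ∈ range (n + 1), IPWB s y * PWB (n - s) y := by
  classical
  have hR : ∑ s ∈ range (n + 1), IPWB s y * PWB (n - s) y =
      ∑ p ∈ (range (n + 1)).sigma (fun s => ipwb s ×ˢ pwb (n - s)),
        y ^ (visits p.1 p.2.1 + visits (n - p.1) p.2.2) := by
    rw [Finset.sum_sigma]
    refine Finset.sum_congr rfl fun s _ => ?_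
    rw [IPWB, PWB, Finset.sum_mul_sum, Finset.sum_product]
    refine Finset.sum_congr rfl fun η _ => Finset.sum_congr rfl fun τ _ => ?_
    rw [pow_add]
  rw [hR, PWB]
  symm
  refine Finset.sum_nbij (fun p => Zd.concatWalk p.1 p.2.1 p.2.2) ?_ ?_ ?_ ?_
  · rintro ⟨s, η, τ⟩ hp
    simp only [Finset.mem_sigma, Finset.mem_range, Finset.mem_product] at hp
    obtain ⟨hsn, hη, hτ⟩ := hp
    exact (concat_mem_pwb (Nat.le_of_lt_succ hsn) (ipwb_subset hη) hτ).1
  · rintro ⟨s, η, τ⟩ hp ⟨s', η', τ'⟩ hp' h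
    simp only [Finset.mem_coe, Finset.mem_sigma, Finset.mem_range, Finset.mem_product] at hp hp'
    obtain ⟨hsn, hη, hτ⟩ := hp
    obtain ⟨hsn', hη', hτ'⟩ := hp'
    replace hsn := Nat.le_of_lt_succ hsn
    replace hsn' := Nat.le_of_lt_succ hsn'
    have hs1 := (mem_ipwb.1 hη).2.1
    have hs1' := (mem_ipwb.1 hη').2.1
    dsimp only at h
    have hren := (concat_mem_pwb hsn (ipwb_subset hη) hτ).2.2
    have hren' := (concat_mem_pwb hsn' (ipwb_subset hη') hτ').2.2
    obtain rfl : s = s' := by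
      by_contra hne
      rcases lt_or_gt_of_ne hne with hlt | hlt
      · rw [h] at hren
        exact not_isWRen_concat_of_lt hsn' hη' hs1 hlt hren
      · rw [← h] at hren'
        exact not_isWRen_concat_of_lt hsn hη hs1' hlt hren'
    obtain ⟨h1, h2⟩ := Zd.concatWalk_injective_pieces (saws_subset _ (saws_of_mem_pwb (ipwb_subset hη)))
      (saws_subset _ (saws_of_mem_pwb hτ)) (saws_subset _ (saws_of_mem_pwb (ipwb_subset hη')))
      (saws_subset _ (saws_of_mem_pwb hτ')) h
    subst h1 h2
    rfl
  · intro ω hω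
    rw [Finset.mem_coe] at hω
    obtain ⟨s, hs1, hs, hmin⟩ := exists_first_wren hn hω
    refine ⟨⟨s, fun i => ω (min i s), fun j => ω (s + j) - ω s⟩, ?_, Zd.concatWalk_head_tail ω⟩
    simp only [Finset.mem_coe, Finset.mem_sigma, Finset.mem_range, Finset.mem_product]
    exact ⟨Nat.lt_succ_of_le hs.1.1, head_mem_ipwb hω hs1 hs hmin, (tail_mem_pwb hω hs).1⟩
  · rintro ⟨s, η, τ⟩ hp
    simp only [Finset.mem_sigma, Finset.mem_range, Finset.mem_product] at hp
    obtain ⟨hsn, hη, hτ⟩ := hp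
    dsimp only
    rw [(concat_mem_pwb (Nat.le_of_lt_succ hsn) (ipwb_subset hη) hτ).2.1]

/-- [folklore] Parity bookkeeping: a sum over `range (2s+1)` split into even and odd indices. -/
private theorem sum_range_two_mul_succ_wren (g : ℕ → ℝ) (s : ℕ) :
    ∑ m ∈ range (2 * s + 1), g m = ∑ k ∈ range (s + 1), g (2 * k) + ∑ k ∈ range s, g (2 * k + 1) := by
  induction s with
  | zero => simp
  | succ s ih =>
    rw [show 2 * (s + 1) + 1 = 2 * s + 1 + 1 + 1 by ring, Finset.sum_range_succ, Finset.sum_range_succ, ih,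
      Finset.sum_range_succ (fun k => g (2 * k)) (s + 1), Finset.sum_range_succ (fun k => g (2 * k + 1)) s]
    simp only [show 2 * (s + 1) = 2 * s + 2 by ring]
    ring

/-- **The renewal equation along even lengths**: `P_{2s}(y) = Σ_{k ≤ s} Λ_{2k}(y) P_{2s-2k}(y)` for `s ≥ 1` (odd
lengths carry no wall bridges). [cite: MadrasSlade1993, §4.2, eq. (4.2.2) (p. 90)] -/
theorem PWB_two_mul_eq_sum {s : ℕ} (hs : 1 ≤ s) (y : ℝ) :
    PWB (2 * s) y = ∑ k ∈ range (s + 1), IPWB (2 * k) y * PWB (2 * s - 2 * k) y := by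
  rw [PWB_eq_sum_range (n := 2 * s) (by omega) y,
    sum_range_two_mul_succ_wren (fun m => IPWB m y * PWB (2 * s - m) y) s]
  have h0 : ∑ k ∈ range s, IPWB (2 * k + 1) y * PWB (2 * s - (2 * k + 1)) y = 0 :=
    Finset.sum_eq_zero fun k _ => by rw [IPWB_eq_zero_of_odd (by omega) y, zero_mul]
  rw [h0, add_zero]

/-! ### §3 The entropy lemma: an irreducible positive wall bridge of length `n` has at most `(n+2)/4` visits -/

/-- Step-index sets of a walk: right steps. [cite: EntingJensen2009, §7.4.2, Fig. 7.10 (brickwork form of the honeycomb lattice)] -/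
def stepsR (n : ℕ) (ω : ℕ → Site 2) : Finset ℕ := (range n).filter fun i => ω (i + 1) 0 = ω i 0 + 1

/-- Left steps. [cite: EntingJensen2009, §7.4.2, Fig. 7.10] -/
def stepsL (n : ℕ) (ω : ℕ → Site 2) : Finset ℕ := (range n).filter fun i => ω (i + 1) 0 = ω i 0 - 1

/-- Up steps. [cite: EntingJensen2009, §7.4.2, Fig. 7.10] -/
def stepsU (n : ℕ) (ω : ℕ → Site 2) : Finset ℕ :=
  (range n).filter fun i => ω (i + 1) 0 = ω i 0 ∧ ω (i + 1) 1 = ω i 1 + 1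

/-- Down steps. [cite: EntingJensen2009, §7.4.2, Fig. 7.10] -/
def stepsD (n : ℕ) (ω : ℕ → Site 2) : Finset ℕ :=
  (range n).filter fun i => ω (i + 1) 0 = ω i 0 ∧ ω (i + 1) 1 = ω i 1 - 1

/-- The visit times `t ∈ [1, n]`, `t` even, `Y_t = 0`. [cite: BeatonBousquetMelouDeGierDuminilCopinGuttmann2014, §3.1 (arXiv v5 p. 8)] -/
def wallTimes (n : ℕ) (ω : ℕ → Site 2) : Finset ℕ := (Icc 1 n).filter fun t => t % 2 = 0 ∧ ω t 1 = 0

/-- `visits n ω` is the number of visit times. [cite: BeatonBousquetMelouDeGierDuminilCopinGuttmann2014, §3.1 (arXiv v5 p. 8)] -/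
theorem visits_eq_card (n : ℕ) (ω : ℕ → Site 2) : visits n ω = #(wallTimes n ω) := by
  induction n with
  | zero => rfl
  | succ n ih =>
    rw [visits_succ, ih, wallTimes, wallTimes, ← Finset.insert_Icc_right_eq_Icc_add_one (by omega : 1 ≤ n + 1),
      Finset.filter_insert]
    split_ifs with h
    · rw [Finset.card_insert_of_notMem fun hm => by
        have := (Finset.mem_Icc.1 (Finset.mem_filter.1 hm).1).2; omega]
    · rfl

/-- The four step types of a brick-wall walk: exactly one of right / left / up / down at every step.
[cite: EntingJensen2009, §7.4.2, Fig. 7.10 (brickwork form of the honeycomb lattice)] -/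
theorem step_cases (hbw : IsBW n ω) {i : ℕ} (hi : i < n) :
    (ω (i + 1) 0 = ω i 0 + 1 ∧ ω (i + 1) 1 = ω i 1) ∨ (ω (i + 1) 0 = ω i 0 - 1 ∧ ω (i + 1) 1 = ω i 1) ∨
      (ω (i + 1) 0 = ω i 0 ∧ ω (i + 1) 1 = ω i 1 + 1) ∨ (ω (i + 1) 0 = ω i 0 ∧ ω (i + 1) 1 = ω i 1 - 1) := by
  have h := (brickWallGraph_adj_coord _ _).1 (hbw i hi)
  omega

/-- Step bookkeeping: `#R + #L + #U + #D = n`, `X_n − X_0 = #R − #L`, `Y_n − Y_0 = #U − #D`.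
[cite: MadrasSlade1993, §1.2 (coordinates of a walk as sums of steps)] -/
theorem steps_count (hbw : IsBW n ω) :
    #(stepsR n ω) + #(stepsL n ω) + #(stepsU n ω) + #(stepsD n ω) = n ∧
      ω n 0 - ω 0 0 = (#(stepsR n ω) : ℤ) - #(stepsL n ω) ∧
      ω n 1 - ω 0 1 = (#(stepsU n ω) : ℤ) - #(stepsD n ω) := by
  have key : ∀ i ∈ range n,
      ((if ω (i + 1) 0 = ω i 0 + 1 then (1 : ℤ) else 0) + (if ω (i + 1) 0 = ω i 0 - 1 then (1 : ℤ) else 0) +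
        (if ω (i + 1) 0 = ω i 0 ∧ ω (i + 1) 1 = ω i 1 + 1 then (1 : ℤ) else 0) +
        (if ω (i + 1) 0 = ω i 0 ∧ ω (i + 1) 1 = ω i 1 - 1 then (1 : ℤ) else 0) = 1) ∧
      (ω (i + 1) 0 - ω i 0 =
        (if ω (i + 1) 0 = ω i 0 + 1 then (1 : ℤ) else 0) - (if ω (i + 1) 0 = ω i 0 - 1 then (1 : ℤ) else 0)) ∧
      (ω (i + 1) 1 - ω i 1 =
        (if ω (i + 1) 0 = ω i 0 ∧ ω (i + 1) 1 = ω i 1 + 1 then (1 : ℤ) else 0) -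
          (if ω (i + 1) 0 = ω i 0 ∧ ω (i + 1) 1 = ω i 1 - 1 then (1 : ℤ) else 0)) := by
    intro i hi
    have h := step_cases hbw (Finset.mem_range.1 hi)
    refine ⟨?_, ?_, ?_⟩ <;> split_ifs <;> omega
  have hX := Finset.sum_range_sub (fun i => ω i 0) n
  have hY := Finset.sum_range_sub (fun i => ω i 1) n
  rw [Finset.sum_congr rfl fun i hi => (key i hi).2.1, Finset.sum_sub_distrib, Finset.sum_boole, Finset.sum_boole]
    at hX
  rw [Finset.sum_congr rfl fun i hi => (key i hi).2.2, Finset.sum_sub_distrib, Finset.sum_boole, Finset.sum_boole]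
    at hY
  have hN : ∑ i ∈ range n, ((if ω (i + 1) 0 = ω i 0 + 1 then (1 : ℤ) else 0) +
      (if ω (i + 1) 0 = ω i 0 - 1 then (1 : ℤ) else 0) +
      (if ω (i + 1) 0 = ω i 0 ∧ ω (i + 1) 1 = ω i 1 + 1 then (1 : ℤ) else 0) +
      (if ω (i + 1) 0 = ω i 0 ∧ ω (i + 1) 1 = ω i 1 - 1 then (1 : ℤ) else 0)) = n := by
    rw [Finset.sum_congr rfl fun i hi => (key i hi).1]; simp
  rw [Finset.sum_add_distrib, Finset.sum_add_distrib, Finset.sum_add_distrib, Finset.sum_boole, Finset.sum_boole,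
    Finset.sum_boole, Finset.sum_boole] at hN
  refine ⟨?_, ?_, ?_⟩
  · have : ((#(stepsR n ω) + #(stepsL n ω) + #(stepsU n ω) + #(stepsD n ω) : ℕ) : ℤ) = n := by
      push_cast; simpa [stepsR, stepsL, stepsU, stepsD] using hN
    exact_mod_cast this
  · simpa [stepsR, stepsL] using hX.symm
  · simpa [stepsU, stepsD] using hY.symm

/-- **Discrete descent**: if `X_a > c ≥ X_b` with `a < b ≤ n`, some step `i ∈ [a, b)` is a left step from column
`c + 1` onto column `c` (`|ΔX| ≤ 1` per step). [cite: MadrasSlade1993, §1.2] -/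
theorem exists_descent (hbw : IsBW n ω) {a b : ℕ} {c : ℤ} (hab : a < b) (hbn : b ≤ n) (ha : c < ω a 0)
    (hb : ω b 0 ≤ c) : ∃ i, a ≤ i ∧ i < b ∧ ω i 0 = c + 1 ∧ ω (i + 1) 0 = c := by
  classical
  have hex : ∃ s, a < s ∧ s ≤ b ∧ ω s 0 ≤ c := ⟨b, hab, le_rfl, hb⟩
  obtain ⟨hs1, hs2, hs3⟩ := Nat.find_spec hex
  set s := Nat.find hex with hs
  have hi : c < ω (s - 1) 0 := by
    rcases eq_or_lt_of_le (show a ≤ s - 1 by omega) with h | h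
    · rw [← h]; exact ha
    · have := Nat.find_min hex (show s - 1 < s by omega)
      rw [not_and, not_and, not_le] at this
      exact this h (by omega)
  have hstep := abs_sub_apply_zero_le_one (hbw (s - 1) (by omega))
  rw [show s - 1 + 1 = s by omega, abs_le] at hstep
  exact ⟨s - 1, by omega, by omega, by omega, by rw [show s - 1 + 1 = s by omega]; omega⟩

/-- **The charging lemma**: in an IRREDUCIBLE positive wall bridge, a visit time `t ∈ [1, n)` left by a right step
is not a wall-renewal time, so the walk either overhangs column `X_t` before time `t` or returns to it after — in
both cases through a left step landing on column `X_t`. [cite: MadrasSlade1993, §4.2, Definition 4.2.1] -/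
theorem exists_left_step_onto (hω : ω ∈ ipwb n) {t : ℕ} (ht1 : 1 ≤ t) (htn : t < n) (ht2 : t % 2 = 0)
    (hY : ω t 1 = 0) (hR : ω (t + 1) 0 = ω t 0 + 1) :
    ∃ i, i < n ∧ ω (i + 1) 0 = ω i 0 - 1 ∧ ω (i + 1) 0 = ω t 0 := by
  obtain ⟨hp, -, hirr⟩ := mem_ipwb.1 hω
  obtain ⟨-, hb⟩ := mem_pwb.1 hp
  obtain ⟨h0, -, hbw, -⟩ := mem_saws_iff.1 (saws_of_mem_pwb hp)
  have hX0 : ω 0 0 = 0 := by rw [h0]; rfl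
  have hnr : ¬ Zd.IsRenewalTime n ω t := fun h => hirr t ht1 htn ⟨h, ht2, hY⟩
  unfold Zd.IsRenewalTime at hnr
  rw [not_and, not_and] at hnr
  have hnr' := hnr htn.le
  by_cases hbt : Zd.IsBridge t ω
  · -- the tail `ω[t, n]` is not a bridge: a return to column `X_t` after time `t`
    have hnt := hnr' hbt
    unfold Zd.IsBridge at hnt
    push Not at hnt
    obtain ⟨j, hj1, hj2, hj⟩ := hnt
    have hle : ω (t + j) 0 ≤ ω t 0 := by
      by_contra hlt
      rw [not_le] at hlt
      have := hj hlt
      rw [show t + (n - t) = n by omega] at this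
      exact absurd (hb (t + j) (by omega) (by omega)).2 (not_le.2 this)
    have hj2' : 2 ≤ j := by
      by_contra h; have : j = 1 := by omega
      subst this; omega
    obtain ⟨i, hi1, hi2, hi3, hi4⟩ := exists_descent hbw (a := t + 1) (b := t + j) (c := ω t 0) (by omega)
      (by omega) (by omega) hle
    exact ⟨i, by omega, by omega, hi4⟩
  · -- the head `ω[0, t]` is not a bridge: an overhang over column `X_t` before time `t`
    unfold Zd.IsBridge at hbt
    push Not at hbt
    obtain ⟨i, hi1, hi2, hi⟩ := hbt
    have hlt : ω t 0 < ω i 0 := hi (hb i hi1 (by omega)).1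
    have hit : i < t := lt_of_le_of_ne hi2 (by rintro rfl; exact lt_irrefl _ hlt)
    obtain ⟨k, hk1, hk2, hk3, hk4⟩ := exists_descent hbw (a := i) (b := t) (c := ω t 0) hit htn.le hlt le_rfl
    exact ⟨k, by omega, by omega, hk4⟩

/-- [folklore] Two coordinates determine a site of `ℤ²`. -/
private theorem site_ext_wren {p q : Site 2} (h0 : p 0 = q 0) (h1 : p 1 = q 1) : p = q := by
  funext k
  fin_cases k
  · exact h0
  · exact h1

/-- **The entropy lemma**: an irreducible positive wall bridge of length `n` has at most `(n + 2)/4` surface visits,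
`4 · visits ≤ n + 2`. (Each visit time `t < n` is charged injectively to a left step — the on-wall left step at `t`, or
an off-wall left step landing on column `X_t` supplied by `exists_left_step_onto` — or to the down step at `t`; the
numbers of up and down steps agree (`Y_0 = Y_n = 0`); and the visits occupy distinct even columns in `(0, X_n]`,
`X_n = #right − #left`.) NEW — the adsorption counterpart of Madras–Slade's "an irreducible bridge of span `L` has at
least `3L` steps". [cite: MadrasSlade1993, §4.2, remark after Theorem 4.2.4 and before (4.2.21) (p. 94: an irreducible bridge of span L ≥ 2 has at least 3L steps)] -/
theorem four_mul_visits_le (hω : ω ∈ ipwb n) : 4 * visits n ω ≤ n + 2 := by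
  classical
  obtain ⟨hp, hn1, hirr⟩ := mem_ipwb.1 hω
  obtain ⟨hw, hb⟩ := mem_pwb.1 hp
  obtain ⟨ha, -⟩ := mem_wbr.1 hw
  obtain ⟨hh, hn2, hYn⟩ := mem_archs.1 ha
  obtain ⟨hs, hhp⟩ := mem_hpw.1 hh
  obtain ⟨h0, hend, hbw, hinj⟩ := mem_saws_iff.1 hs
  have hX0 : ω 0 0 = 0 := by rw [h0]; rfl
  have hY0 : ω 0 1 = 0 := by rw [h0]; rfl
  obtain ⟨hcnt, hX, hY⟩ := steps_count hbw
  rw [hX0, sub_zero] at hX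
  rw [hY0, hYn, sub_zero] at hY
  set R := stepsR n ω
  set L := stepsL n ω
  set U := stepsU n ω
  set D := stepsD n ω
  set W := wallTimes n ω with hWdef
  have hmemW : ∀ {t}, t ∈ W ↔ (1 ≤ t ∧ t ≤ n) ∧ t % 2 = 0 ∧ ω t 1 = 0 := fun {t} => by
    rw [hWdef, wallTimes, Finset.mem_filter, Finset.mem_Icc]
  -- visits at distinct sites on the wall determine their times
  have hWinj : ∀ {t t'}, t ∈ W → t' ∈ W → ω t 0 = ω t' 0 → t = t' := fun {t t'} ht ht' he => by
    obtain ⟨⟨-, htn⟩, -, hy⟩ := hmemW.1 ht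
    obtain ⟨⟨-, htn'⟩, -, hy'⟩ := hmemW.1 ht'
    exact hinj (show t ∈ {i | i ≤ n} from htn) (show t' ∈ {i | i ≤ n} from htn') (site_ext_wren he (by rw [hy, hy']))
  have hWeven : ∀ {t}, t ∈ W → ω t 0 % 2 = 0 ∧ 0 < ω t 0 ∧ ω t 0 ≤ ω n 0 := fun {t} ht => by
    obtain ⟨⟨ht1, htn⟩, ht2, hy⟩ := hmemW.1 ht
    have hpar := parity_apply hs htn
    rw [hy, add_zero] at hpar
    have hbt := hb t ht1 htn
    rw [hX0] at hbt
    exact ⟨by omega, hbt.1, hbt.2⟩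
  -- (A) `2 · #W ≤ X_n`
  have hA : 2 * (#W : ℤ) ≤ ω n 0 := by
    have h1 : #W ≤ #(Finset.Icc (1 : ℤ) (ω n 0 / 2)) := by
      refine Finset.card_le_card_of_injOn (fun t => ω t 0 / 2) (fun t ht => ?_) (fun t ht t' ht' he => ?_)
      · obtain ⟨he, hpos, hle⟩ := hWeven (Finset.mem_coe.1 ht)
        rw [Finset.mem_coe, Finset.mem_Icc]
        show 1 ≤ ω t 0 / 2 ∧ ω t 0 / 2 ≤ ω n 0 / 2
        constructor <;> omega
      · obtain ⟨he1, -, -⟩ := hWeven (Finset.mem_coe.1 ht)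
        obtain ⟨he2, -, -⟩ := hWeven (Finset.mem_coe.1 ht')
        exact hWinj (Finset.mem_coe.1 ht) (Finset.mem_coe.1 ht') (by dsimp only at he; omega)
    rw [Int.card_Icc] at h1
    have h0n : 0 ≤ ω n 0 := by
      rcases Nat.eq_zero_or_pos n with h | h
      · omega
      · have := (hb n h le_rfl); rw [hX0] at this; exact this.1.le
    have : ((#W : ℕ) : ℤ) ≤ ω n 0 / 2 := by
      have := Int.toNat_of_nonneg (show (0 : ℤ) ≤ ω n 0 / 2 + 1 - 1 by omega)
      omega
    omega
  -- (B) `#W ≤ #L + #D + 1`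
  have hnW : n ∈ W := hmemW.2 ⟨⟨hn1, le_rfl⟩, hn2, hYn⟩
  set W' := W.erase n with hW'def
  have hWW' : #W = #W' + 1 := (Finset.card_erase_add_one hnW).symm
  have hmemW' : ∀ {t}, t ∈ W' → 1 ≤ t ∧ t < n ∧ t % 2 = 0 ∧ ω t 1 = 0 ∧ t ∈ W := fun {t} ht => by
    obtain ⟨hne, htW⟩ := Finset.mem_erase.1 ht
    obtain ⟨⟨ht1, htn⟩, ht2, hy⟩ := hmemW.1 htW
    exact ⟨ht1, lt_of_le_of_ne htn hne, ht2, hy, htW⟩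
  -- the three classes of interior visit times, by the type of the step leaving the wall
  set WL := W'.filter fun t => ω (t + 1) 0 = ω t 0 - 1 with hWL
  set WD := W'.filter fun t => ω (t + 1) 0 = ω t 0 ∧ ω (t + 1) 1 = ω t 1 - 1 with hWD
  set WR := W'.filter fun t => ω (t + 1) 0 = ω t 0 + 1 with hWR
  have hcover : W' ⊆ WL ∪ WD ∪ WR := fun t ht => by
    obtain ⟨ht1, htn, ht2, hy, -⟩ := hmemW' ht
    rw [Finset.mem_union, Finset.mem_union, hWL, hWD, hWR, Finset.mem_filter, Finset.mem_filter, Finset.mem_filter]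
    rcases step_cases hbw htn with h | h | h | h
    · exact Or.inr ⟨ht, h.1⟩
    · exact Or.inl (Or.inl ⟨ht, h.1⟩)
    · exact absurd (hhp (t + 1) (by omega)) (by rw [h.2, hy]; norm_num)
    · exact Or.inl (Or.inr ⟨ht, h⟩)
  set Lod := L.filter fun i => ¬ ω (i + 1) 0 % 2 = 0 with hLod
  set Lev := L.filter fun i => ω (i + 1) 0 % 2 = 0 with hLev
  have hLsplit : #Lev + #Lod = #L := Finset.card_filter_add_card_filter_not _
  have hmemL : ∀ {i}, i ∈ L ↔ i < n ∧ ω (i + 1) 0 = ω i 0 - 1 := fun {i} => by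
    show i ∈ stepsL n ω ↔ _; rw [stepsL, Finset.mem_filter, Finset.mem_range]
  have hBL : #WL ≤ #Lod := by
    refine Finset.card_le_card fun t ht => ?_
    rw [hWL, Finset.mem_filter] at ht
    obtain ⟨ht', hl⟩ := ht
    obtain ⟨ht1, htn, ht2, hy, htW⟩ := hmemW' ht'
    have := (hWeven htW).1
    rw [hLod, Finset.mem_filter, hmemL]
    exact ⟨⟨htn, hl⟩, by omega⟩
  have hBD : #WD ≤ #D := by
    refine Finset.card_le_card fun t ht => ?_
    rw [hWD, Finset.mem_filter] at ht
    obtain ⟨ht', hd⟩ := ht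
    obtain ⟨ht1, htn, -, -, -⟩ := hmemW' ht'
    show t ∈ stepsD n ω
    rw [stepsD, Finset.mem_filter, Finset.mem_range]
    exact ⟨htn, hd⟩
  have hBR : #WR ≤ #Lev := by
    -- the charging map: a left step landing on column `X_t`
    have hex : ∀ t ∈ WR, ∃ i, i < n ∧ ω (i + 1) 0 = ω i 0 - 1 ∧ ω (i + 1) 0 = ω t 0 := fun t ht => by
      rw [hWR, Finset.mem_filter] at ht
      obtain ⟨ht', hr⟩ := ht
      obtain ⟨ht1, htn, ht2, hy, -⟩ := hmemW' ht'
      exact exists_left_step_onto hω ht1 htn ht2 hy hr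
    let φ : ℕ → ℕ := fun t => if h : t ∈ WR then Classical.choose (hex t h) else 0
    have hφ : ∀ t (h : t ∈ WR), φ t < n ∧ ω (φ t + 1) 0 = ω (φ t) 0 - 1 ∧ ω (φ t + 1) 0 = ω t 0 := fun t h => by
      simp only [φ, dif_pos h]; exact Classical.choose_spec (hex t h)
    refine Finset.card_le_card_of_injOn φ (fun t ht => ?_) (fun t ht t' ht' he => ?_)
    · have ht' := Finset.mem_coe.1 ht
      obtain ⟨h1, h2, h3⟩ := hφ t ht'
      have htW := (hmemW' (Finset.mem_filter.1 (by rw [hWR] at ht'; exact ht')).1).2.2.2.2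
      rw [Finset.mem_coe, hLev, Finset.mem_filter, hmemL]
      exact ⟨⟨h1, h2⟩, by rw [h3]; exact (hWeven htW).1⟩
    · have h1 := Finset.mem_coe.1 ht
      have h2 := Finset.mem_coe.1 ht'
      obtain ⟨-, -, e1⟩ := hφ t h1
      obtain ⟨-, -, e2⟩ := hφ t' h2
      have htW := (hmemW' (Finset.mem_filter.1 (by rw [hWR] at h1; exact h1)).1).2.2.2.2
      have htW' := (hmemW' (Finset.mem_filter.1 (by rw [hWR] at h2; exact h2)).1).2.2.2.2
      exact hWinj htW htW' (by rw [← e1, ← e2, he])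
  have hB : #W ≤ #L + #D + 1 := by
    have h1 := Finset.card_le_card hcover
    have h2 := Finset.card_union_le (WL ∪ WD) WR
    have h3 := Finset.card_union_le WL WD
    omega
  -- conclusion
  rw [visits_eq_card]
  have hB' : ((#W : ℕ) : ℤ) ≤ #L + #D + 1 := by exact_mod_cast hB
  have hcnt' : ((#R + #L + #U + #D : ℕ) : ℤ) = n := by exact_mod_cast hcnt
  push_cast at hcnt'
  have : (4 * (#W : ℕ) : ℤ) ≤ n + 2 := by linarith
  exact_mod_cast this

/-! ### §4 The geometric envelope of the irreducible law -/

/-- [folklore] `1 ≤ μ(ℍ)`: `1 ≤ β(1)²` and `β(1) ≤ μ`. -/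
private theorem one_le_mu_wren : 1 ≤ hexConnectiveConstant := by
  have h1 : (1 : ℝ) ≤ wallRate 1 ^ 2 := le_sq_wallRate_wren one_pos
  have h2 : 1 ≤ wallRate 1 := by
    by_contra h
    exact absurd h1 (not_le.2 (pow_lt_one₀ (wallRate_pos 1).le (not_le.1 h) two_ne_zero))
  exact h2.trans wallRate_one_le

/-- [folklore] `μ⁴ < y` forces `1 ≤ y`. -/
private theorem one_le_of_mu_four_lt_wren (hy : hexConnectiveConstant ^ 4 < y) : 1 ≤ y :=
  (one_le_pow₀ one_le_mu_wren).trans hy.le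

/-- [folklore] `θ(y) := μ²/√y < 1` iff `μ⁴ < y`. -/
private theorem theta_lt_one_wren (hy : hexConnectiveConstant ^ 4 < y) : hexConnectiveConstant ^ 2 / Real.sqrt y < 1 := by
  have hμ := hexConnectiveConstant_pos
  have hy0 : 0 < y := lt_of_le_of_lt (by positivity) hy
  rw [div_lt_one (Real.sqrt_pos.2 hy0), Real.lt_sqrt (by positivity)]
  calc (hexConnectiveConstant ^ 2) ^ 2 = hexConnectiveConstant ^ 4 := by ring
    _ < y := hy

/-- [folklore] `0 < θ(y) = μ²/√y` for `0 < y`. -/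
private theorem theta_pos_wren (hy : 0 < y) : 0 < hexConnectiveConstant ^ 2 / Real.sqrt y :=
  div_pos (pow_pos hexConnectiveConstant_pos 2) (Real.sqrt_pos.2 hy)

/-- **Envelope of the irreducible count** (`y ≥ 1`): `IPWB_{2s}(y) ≤ μ^{2s+2} (√y)^{s+1}` — the entropy lemma
`4·visits ≤ 2s+2` gives `y^{visits} ≤ (√y)^{s+1}`, and `#ipwb_{2s} ≤ #wbr_{2s} ≤ μ^{2s+2}`.
[cite: MadrasSlade1993, §4.2, remark before (4.2.21) (p. 94)] [cite: MadrasSlade1993, §1.2, (1.2.16)–(1.2.17) (p. 11)] -/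
theorem IPWB_le_pow_mul_sqrt_pow (hy : 1 ≤ y) (s : ℕ) :
    IPWB (2 * s) y ≤ hexConnectiveConstant ^ (2 * s + 2) * Real.sqrt y ^ (s + 1) := by
  have hsq : 1 ≤ Real.sqrt y := Real.one_le_sqrt.2 hy
  have hterm : ∀ ω ∈ ipwb (2 * s), y ^ visits (2 * s) ω ≤ Real.sqrt y ^ (s + 1) := fun ω hω => by
    have h4 := four_mul_visits_le hω
    calc y ^ visits (2 * s) ω = Real.sqrt y ^ (2 * visits (2 * s) ω) := by
          rw [pow_mul, Real.sq_sqrt (by linarith)]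
      _ ≤ Real.sqrt y ^ (s + 1) := pow_le_pow_right₀ hsq (by omega)
  have hcard : (#(ipwb (2 * s)) : ℝ) ≤ #(wbr (2 * s)) := by
    exact_mod_cast Finset.card_le_card (ipwb_subset.trans pwb_subset)
  calc IPWB (2 * s) y ≤ ∑ ω ∈ ipwb (2 * s), Real.sqrt y ^ (s + 1) := Finset.sum_le_sum hterm
    _ = #(ipwb (2 * s)) * Real.sqrt y ^ (s + 1) := by rw [Finset.sum_const, nsmul_eq_mul]
    _ ≤ #(wbr (2 * s)) * Real.sqrt y ^ (s + 1) := mul_le_mul_of_nonneg_right hcard (by positivity)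
    _ ≤ _ := mul_le_mul_of_nonneg_right (card_wbr_le_pow (2 * s)) (by positivity)

/-- The renewal sequence of positive wall bridges: `u_s(y) := PWB_{2s}(y) / β(y)^{2s}`.
[cite: MadrasSlade1993, §4.2, eq. (4.2.5) (p. 91) and Theorem 4.2.2(b) (pp. 91–92)] -/
noncomputable def pwbAmp (y : ℝ) (s : ℕ) : ℝ := PWB (2 * s) y / wallRate y ^ (2 * s)

/-- The (defective a priori) renewal law of the first wall-renewal time: `f_s(y) := IPWB_{2s}(y) / β(y)^{2s}`.
[cite: MadrasSlade1993, §4.2, eqs. (4.2.4)–(4.2.5) (p. 91)] -/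
noncomputable def pwbLaw (y : ℝ) (s : ℕ) : ℝ := IPWB (2 * s) y / wallRate y ^ (2 * s)

/-- The mean wall-renewal time `m(y) := Σ_s s f_s(y)`. [cite: MadrasSlade1993, §4.2, Theorem 4.2.2(b) (pp. 91–92)]
[cite: Feller1968, XIII.3, Theorem 3 (renewal theorem)] -/
noncomputable def pwbMean (y : ℝ) : ℝ := ∑' s : ℕ, (s : ℝ) * pwbLaw y s

/-- `u_0 = 1`. [cite: Feller1968, XIII.3 (u₀ = 1)] -/
theorem pwbAmp_zero : pwbAmp y 0 = 1 := by simp [pwbAmp, PWB_zero]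

/-- `0 ≤ u_s`. [cite: Feller1968, XIII.3] -/
theorem pwbAmp_nonneg (hy : 0 ≤ y) (s : ℕ) : 0 ≤ pwbAmp y s :=
  div_nonneg (PWB_nonneg _ hy) (pow_nonneg (wallRate_pos y).le _)

/-- `u_s ≤ 1`, i.e. `PWB_{2s} ≤ β^{2s}`. [cite: MadrasSlade1993, §1.2, (1.2.17) (b_n ≤ μⁿ)] -/
theorem pwbAmp_le_one (hy : 0 < y) (s : ℕ) : pwbAmp y s ≤ 1 :=
  (div_le_one (pow_pos (wallRate_pos y) _)).2 (PWB_le_pow hy s)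

/-- `0 ≤ f_s`. [cite: Feller1968, XIII.3] -/
theorem pwbLaw_nonneg (hy : 0 ≤ y) (s : ℕ) : 0 ≤ pwbLaw y s :=
  div_nonneg (IPWB_nonneg _ hy) (pow_nonneg (wallRate_pos y).le _)

/-- `f_0 = 0`. [cite: Feller1968, XIII.3 (f₀ = 0)] -/
theorem pwbLaw_zero : pwbLaw y 0 = 0 := by simp [pwbLaw, IPWB_zero]

/-- `f_s ≤ u_s`. [cite: MadrasSlade1993, §4.2, (4.2.2)] -/
theorem pwbLaw_le_pwbAmp (hy : 0 ≤ y) (s : ℕ) : pwbLaw y s ≤ pwbAmp y s :=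
  div_le_div_of_nonneg_right (IPWB_le_PWB _ hy) (pow_nonneg (wallRate_pos y).le _)

/-- **The normalised renewal equation** `u_s = Σ_{k ≤ s} f_k u_{s−k}` (`s ≥ 1`).
[cite: MadrasSlade1993, §4.2, eqs. (4.2.2) (p. 90) and (4.2.5) (p. 91)] [cite: Feller1968, XIII.3 (3.1)] -/
theorem pwbAmp_eq_sum {s : ℕ} (hs : 1 ≤ s) : pwbAmp y s = ∑ k ∈ range (s + 1), pwbLaw y k * pwbAmp y (s - k) := by
  rw [pwbAmp, PWB_two_mul_eq_sum hs, Finset.sum_div]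
  refine Finset.sum_congr rfl fun k hk => ?_
  have hk' : k ≤ s := by have := Finset.mem_range.1 hk; omega
  rw [pwbLaw, pwbAmp, div_mul_div_comm, ← pow_add, show 2 * (s - k) = 2 * s - 2 * k by omega,
    show 2 * k + (2 * s - 2 * k) = 2 * s by omega]

/-- **Geometric envelope of the renewal law**: for `y ≥ 1`, `f_s(y) ≤ μ²√y · θ^s` with `θ = μ²/√y`
(`β(y)² ≥ y`). [cite: MadrasSlade1993, §4.2, remark before (4.2.21) (p. 94)] [cite: Feller1968, XIII.3] -/
theorem pwbLaw_le_geom (hy : 1 ≤ y) (s : ℕ) :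
    pwbLaw y s ≤ hexConnectiveConstant ^ 2 * Real.sqrt y * (hexConnectiveConstant ^ 2 / Real.sqrt y) ^ s := by
  have hy0 : 0 < y := by linarith
  have hsq0 : 0 < Real.sqrt y := Real.sqrt_pos.2 hy0
  have hys : y ^ s ≤ wallRate y ^ (2 * s) := by
    rw [pow_mul]; exact pow_le_pow_left₀ hy0.le (le_sq_wallRate_wren hy0) s
  calc pwbLaw y s ≤ IPWB (2 * s) y / y ^ s := div_le_div_of_nonneg_left (IPWB_nonneg _ hy0.le) (pow_pos hy0 s) hys
    _ ≤ hexConnectiveConstant ^ (2 * s + 2) * Real.sqrt y ^ (s + 1) / y ^ s :=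
        div_le_div_of_nonneg_right (IPWB_le_pow_mul_sqrt_pow hy s) (pow_nonneg hy0.le s)
    _ = _ := by
        rw [show y ^ s = Real.sqrt y ^ (2 * s) by rw [pow_mul, Real.sq_sqrt hy0.le], div_pow]
        field_simp
        ring

/-! ### §5 Recurrence: exponential growth of `u_s ρ^s` and the Kesten relation `Σ f_s = 1` for `y > μ⁴` -/

/-- **Growth**: `u_s ρ^s` is unbounded for every `ρ > 1` — from `y·WB_{2j} ≤ PWB_{2j+2}` and the Fekete lower envelope
`(r²/y) r^{2j} ≤ WB_{2j}` for `r < β`. [cite: MadrasSlade1993, §1.2, Lemma 1.2.2 (p. 9) and (1.2.16) (p. 11)]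
[cite: Feller1968, XIII.3, Theorem 2 (persistence)] -/
theorem pwbAmp_mul_pow_unbounded (hy : 0 < y) {ρ : ℝ} (hρ : 1 < ρ) (M : ℝ) : ∃ s, M < pwbAmp y s * ρ ^ s := by
  have hβ := wallRate_pos y
  have hβ2 : 0 < wallRate y ^ 2 := pow_pos hβ 2
  have hρ0 : (0 : ℝ) < ρ := by linarith
  obtain ⟨q, hq1, hq2⟩ := exists_between (div_lt_self hβ2 hρ)
  have hq0 : 0 < q := (div_pos hβ2 hρ0).trans hq1
  have hr0 : 0 < Real.sqrt q := Real.sqrt_pos.2 hq0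
  have hrβ : Real.sqrt q < wallRate y := by
    calc Real.sqrt q < Real.sqrt (wallRate y ^ 2) := Real.sqrt_lt_sqrt hq0.le hq2
      _ = wallRate y := Real.sqrt_sq hβ.le
  have hr2 : Real.sqrt q ^ 2 = q := Real.sq_sqrt hq0.le
  have hκ : 1 < q * ρ / wallRate y ^ 2 := by
    rw [lt_div_iff₀ hβ2, one_mul]
    rwa [div_lt_iff₀ hρ0] at hq1
  have hev1 := eventually_mul_pow_le_WB hy hr0 hrβ
  have hev2 := ((tendsto_pow_atTop_atTop_of_one_lt hκ).comp (tendsto_add_atTop_nat 1)).eventually_gt_atTop M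
  obtain ⟨j, hj1, hj2⟩ := (hev1.and hev2).exists
  refine ⟨j + 1, lt_of_lt_of_le hj2 ?_⟩
  have hq_le : q ^ (j + 1) ≤ PWB (2 * (j + 1)) y := by
    have h1 := mul_WB_le_PWB (2 * j) hy.le
    rw [show 2 + 2 * j = 2 * (j + 1) by ring] at h1
    have h2 : q ^ (j + 1) = y * (Real.sqrt q ^ 2 / y * Real.sqrt q ^ (2 * j)) := by
      rw [pow_mul, hr2]; field_simp; ring
    rw [h2]
    exact (mul_le_mul_of_nonneg_left hj1 hy.le).trans h1
  show (q * ρ / wallRate y ^ 2) ^ (j + 1) ≤ pwbAmp y (j + 1) * ρ ^ (j + 1)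
  rw [div_pow, mul_pow, ← pow_mul, pwbAmp, div_mul_eq_mul_div]
  exact div_le_div_of_nonneg_right (mul_le_mul_of_nonneg_right hq_le (pow_nonneg hρ0.le _))
    (pow_nonneg hβ.le _)

/-- **The Kesten relation of the adsorbed phase**: for `y > μ⁴ = (2+√2)² = 6 + 4√2`, `Σ_s IPWB_{2s}(y) β(y)^{-2s} = 1`
— the first wall-renewal time of a positive wall bridge is a.s. finite under the `β`-tilted weights. (Persistence from the
geometric envelope `θ = μ²/√y < 1` plus exponential growth.) NEW for the surface-weighted honeycomb model; the bulk
analogue is Kesten's relation `Σ λ_n μ^{-n} = 1`. [cite: MadrasSlade1993, §4.2, eq. (4.2.4) (p. 91) and Theorem 4.2.2(b) (pp. 91–92)]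
[cite: Kesten1963SAW, §4] [cite: Feller1968, XIII.3, Theorem 2 (persistence)] -/
theorem hasSum_pwbLaw (hy : hexConnectiveConstant ^ 4 < y) : HasSum (pwbLaw y) 1 := by
  have hy1 := one_le_of_mu_four_lt_wren hy
  have hy0 : 0 < y := by linarith
  exact Literature.Probability.Process.Renewal.hasSum_f_one_of_envelope (u := pwbAmp y) (f := pwbLaw y) pwbAmp_zero
    (pwbAmp_nonneg hy0.le) (pwbAmp_le_one hy0) (pwbLaw_nonneg hy0.le) pwbLaw_zero (fun n hn => pwbAmp_eq_sum hn)
    (theta_pos_wren hy0) (theta_lt_one_wren hy) (pwbLaw_le_geom hy1) (fun ρ hρ M => pwbAmp_mul_pow_unbounded hy0 hρ M)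

/-- **Finite mean renewal time** for `y > μ⁴`: `Σ_s s f_s(y) < ∞`. [cite: MadrasSlade1993, §4.2, Theorem 4.2.2(b) (pp. 91–92)]
[cite: Feller1968, XIII.3] -/
theorem summable_mul_pwbLaw (hy : hexConnectiveConstant ^ 4 < y) : Summable fun s : ℕ => (s : ℝ) * pwbLaw y s := by
  have hy1 := one_le_of_mu_four_lt_wren hy
  have hy0 : 0 < y := by linarith
  exact Literature.Probability.Process.Renewal.summable_mul_f_of_envelope (pwbLaw_nonneg hy0.le) (theta_pos_wren hy0)
    (theta_lt_one_wren hy) (pwbLaw_le_geom hy1)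

/-! ### §6 The renewal theorem: `PWB_{2s}(y) β(y)^{-2s} → 1/m(y)`, two-sided bounds, explicit rate -/

/-- `f_1(y) = IPWB_2(y)/β² > 0` (the two-step bridge `(0,0) → (1,0) → (2,0)` is irreducible): aperiodicity.
[cite: Feller1968, XIII.3 (aperiodicity)] [cite: BeatonBousquetMelouDeGierDuminilCopinGuttmann2014, §3.1] -/
theorem pwbLaw_one_pos (hy : 0 < y) : 0 < pwbLaw y 1 := by
  have hmem : Zd.straightWalk 2 2 ∈ ipwb 2 := by
    rw [mem_ipwb]
    refine ⟨(straightWalk_mem_pwb 1).1, by norm_num, fun k hk1 hk2 h => ?_⟩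
    have hk : k = 1 := by omega
    subst hk
    exact absurd h.2.1 (by norm_num)
  have hv : visits 2 (Zd.straightWalk 2 2) = 1 := (straightWalk_mem_pwb 1).2
  have h1 : y ≤ IPWB 2 y := by
    calc y = y ^ visits 2 (Zd.straightWalk 2 2) := by rw [hv, pow_one]
      _ ≤ IPWB 2 y := Finset.single_le_sum (f := fun ω => y ^ visits 2 ω) (fun ω _ => pow_nonneg hy.le _) hmem
  show 0 < IPWB 2 y / wallRate y ^ 2
  exact div_pos (hy.trans_le h1) (pow_pos (wallRate_pos y) _)

/-- **The renewal theorem for adsorbed wall bridges**: for `y > μ⁴`, `PWB_{2s}(y)/β(y)^{2s} → 1/m(y)` with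
`1 ≤ m(y) < ∞` — PURE exponential growth of positive wall bridges in the adsorbed regime `y > 6 + 4√2`. NEW.
[cite: MadrasSlade1993, §4.2, Theorem 4.2.2(b) (pp. 91–92)] [cite: Feller1968, XIII.3, Theorem 3 (renewal theorem) and Ch. XIII §11]
[cite: HammersleyTorrieWhittington1982, §2 (surface free energy of bridges)] -/
theorem tendsto_pwbAmp (hy : hexConnectiveConstant ^ 4 < y) : Tendsto (pwbAmp y) atTop (𝓝 (pwbMean y)⁻¹) := by
  have hy1 := one_le_of_mu_four_lt_wren hy
  have hy0 : 0 < y := by linarith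
  exact Literature.Probability.Process.Renewal.tendsto_of_summable_mul pwbAmp_zero (pwbAmp_nonneg hy0.le)
    (pwbAmp_le_one hy0) (pwbLaw_nonneg hy0.le) pwbLaw_zero (fun n hn => pwbAmp_eq_sum hn) (hasSum_pwbLaw hy)
    (pwbLaw_one_pos hy0) (summable_mul_pwbLaw hy)

/-- `1 ≤ m(y)` (`f_0 = 0`, `Σ f = 1`). [cite: Feller1968, XIII.3] -/
theorem one_le_pwbMean (hy : hexConnectiveConstant ^ 4 < y) : 1 ≤ pwbMean y := by
  have hy1 := one_le_of_mu_four_lt_wren hy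
  have hy0 : 0 < y := by linarith
  have hf1 := hasSum_pwbLaw hy
  rw [pwbMean, ← hf1.tsum_eq]
  refine Summable.tsum_le_tsum (fun k => ?_) hf1.summable (summable_mul_pwbLaw hy)
  rcases Nat.eq_zero_or_pos k with h | h
  · subst h; simp [pwbLaw_zero]
  · exact le_mul_of_one_le_left (pwbLaw_nonneg hy0.le k) (by exact_mod_cast h)

/-- `0 < m(y)`. [cite: Feller1968, XIII.3] -/
theorem pwbMean_pos (hy : hexConnectiveConstant ^ 4 < y) : 0 < pwbMean y := one_pos.trans_le (one_le_pwbMean hy)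

/-- **Two-sided bound for all `s`** (the renewal inequality `u_s ≥ 2 − m`): `(2 − m(y)) β^{2s} ≤ PWB_{2s}(y) ≤ β^{2s}`.
[cite: MadrasSlade1993, §4.2, Theorem 4.2.2(b) (pp. 91–92)] [cite: Feller1968, XIII.3, Theorem 3 and Ch. XIII §11] -/
theorem PWB_two_sided (hy : hexConnectiveConstant ^ 4 < y) (s : ℕ) :
    (2 - pwbMean y) * wallRate y ^ (2 * s) ≤ PWB (2 * s) y ∧ PWB (2 * s) y ≤ wallRate y ^ (2 * s) := by
  have hy1 := one_le_of_mu_four_lt_wren hy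
  have hy0 : 0 < y := by linarith
  have hB : 0 < wallRate y ^ (2 * s) := pow_pos (wallRate_pos y) _
  refine ⟨?_, PWB_le_pow hy0 s⟩
  have h := Zd.renewal_two_sub_tsum_le pwbAmp_zero (pwbAmp_le_one hy0) (pwbLaw_nonneg hy0.le) pwbLaw_zero
    (fun n hn => pwbAmp_eq_sum hn) (hasSum_pwbLaw hy) (summable_mul_pwbLaw hy) s
  change 2 - pwbMean y ≤ PWB (2 * s) y / wallRate y ^ (2 * s) at h
  rwa [le_div_iff₀ hB] at h

/-- The same lower bound for ALL wall bridges: `(2 − m(y)) β^{2s} ≤ WB_{2s}(y)` for every `s`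
(with the tree's `WB_{2s} ≤ (β²/y) β^{2s}` this is a two-sided bound with explicit constants).
[cite: MadrasSlade1993, §4.2, Theorem 4.2.2(b) (pp. 91–92)] [cite: HammersleyTorrieWhittington1982, §2] -/
theorem two_sub_pwbMean_mul_pow_le_WB (hy : hexConnectiveConstant ^ 4 < y) (s : ℕ) :
    (2 - pwbMean y) * wallRate y ^ (2 * s) ≤ WB (2 * s) y := by
  have hy1 := one_le_of_mu_four_lt_wren hy
  exact (PWB_two_sided hy s).1.trans (PWB_le_WB _ (by linarith))

/-- **Explicit geometric rate** (in `_of` form: the two generating-function values `G < 1`, `H` of the tail sums at a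
radius `ρ ≥ 1` are the finite data): `|PWB_{2s} β^{-2s} − 1/m| ≤ H/(m(1−G)) · ρ^{-s}`.
[cite: Feller1968, Ch. XIII §11 (proof of the renewal theorem)] [cite: MadrasSlade1993, §4.2, Theorem 4.2.2(b) (pp. 91–92)] -/
theorem abs_pwbAmp_sub_inv_pwbMean_le (hy : hexConnectiveConstant ^ 4 < y) {ρ G H : ℝ} (hρ : 1 ≤ ρ)
    (hG : HasSum (fun j : ℕ => (1 - ∑ k ∈ range (j + 2), pwbLaw y k) * ρ ^ (j + 1)) G) (hG1 : G < 1)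
    (hH : HasSum (fun j : ℕ => (1 - ∑ k ∈ range (j + 2), pwbLaw y k) * ∑ l ∈ range (j + 1), ρ ^ l) H) (s : ℕ) :
    |pwbAmp y s - (pwbMean y)⁻¹| ≤ H / (pwbMean y * (1 - G)) * ρ⁻¹ ^ s := by
  have hy1 := one_le_of_mu_four_lt_wren hy
  have hy0 : 0 < y := by linarith
  exact Literature.Probability.Process.Renewal.abs_sub_inv_tsum_le pwbAmp_zero (pwbLaw_nonneg hy0.le) pwbLaw_zero
    (fun n hn => pwbAmp_eq_sum hn) (hasSum_pwbLaw hy) (summable_mul_pwbLaw hy) hρ hG hG1 hH s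

/-- For every `c < 1/m(y)`: eventually `c β^{2s} ≤ PWB_{2s}(y) ≤ WB_{2s}(y)` — the wall-bridge counts of the adsorbed
phase are of PURE exponential order `β^{2s}` (no sub-exponential correction), sharpening the tree's Fekete envelope
`eventually_mul_pow_le_WB` (`r < β`) to the rate `β` itself. [cite: MadrasSlade1993, §4.2, Theorem 4.2.2(b) (pp. 91–92)]
[cite: HammersleyTorrieWhittington1982, §2] -/
theorem eventually_mul_pow_le_WB_of_lt_inv_pwbMean (hy : hexConnectiveConstant ^ 4 < y) {c : ℝ}
    (hc : c < (pwbMean y)⁻¹) : ∀ᶠ s : ℕ in atTop, c * wallRate y ^ (2 * s) ≤ PWB (2 * s) y ∧ PWB (2 * s) y ≤ WB (2 * s) y := by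
  have hy1 := one_le_of_mu_four_lt_wren hy
  filter_upwards [(tendsto_pwbAmp hy).eventually (eventually_gt_nhds hc)] with s hs
  have hB : 0 < wallRate y ^ (2 * s) := pow_pos (wallRate_pos y) _
  exact ⟨((lt_div_iff₀ hB).1 hs).le, PWB_le_WB _ (by linarith)⟩

/-- **Ratio limit**: `PWB_{2s+2}(y)/PWB_{2s}(y) → β(y)²` for `y > μ⁴`. [cite: MadrasSlade1993, §4.2, Theorem 4.2.2(b) (pp. 91–92)]
[cite: Feller1968, XIII.3, Theorem 3 (renewal theorem)] -/
theorem tendsto_PWB_ratio (hy : hexConnectiveConstant ^ 4 < y) :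
    Tendsto (fun s : ℕ => PWB (2 * s + 2) y / PWB (2 * s) y) atTop (𝓝 (wallRate y ^ 2)) := by
  have hy1 := one_le_of_mu_four_lt_wren hy
  have hy0 : 0 < y := by linarith
  have hL : (pwbMean y)⁻¹ ≠ 0 := inv_ne_zero (pwbMean_pos hy).ne'
  have h1 := (((tendsto_pwbAmp hy).comp (tendsto_add_atTop_nat 1)).div (tendsto_pwbAmp hy) hL).const_mul
    (wallRate y ^ 2)
  rw [div_self hL, mul_one] at h1
  refine h1.congr fun s => ?_
  have hP : PWB (2 * s) y ≠ 0 := (PWB_pos hy0 s).ne'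
  have hβ : wallRate y ≠ 0 := (wallRate_pos y).ne'
  show wallRate y ^ 2 * (pwbAmp y (s + 1) / pwbAmp y s) = PWB (2 * s + 2) y / PWB (2 * s) y
  rw [pwbAmp, pwbAmp, show 2 * (s + 1) = 2 * s + 2 by ring]
  field_simp
  ring

/-- **Explicit mean bound**: `m(y) ≤ 1 + μ⁴ θ/(1−θ)²`, `θ = μ²/√y` (from `f_1 ≤ 1` and `f_k ≤ μ²√y θ^k`); in particular the
all-`s` lower constant `2 − m(y)` of `PWB_two_sided` is explicit and positive once `μ⁴ θ < (1−θ)²`.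
[cite: Feller1968, XIII.3] [cite: MadrasSlade1993, §4.2, remark before (4.2.21) (p. 94)] -/
theorem pwbMean_le (hy : hexConnectiveConstant ^ 4 < y) :
    pwbMean y ≤ 1 + hexConnectiveConstant ^ 4 *
      ((hexConnectiveConstant ^ 2 / Real.sqrt y) / (1 - hexConnectiveConstant ^ 2 / Real.sqrt y) ^ 2) := by
  have hy1 := one_le_of_mu_four_lt_wren hy
  have hy0 : 0 < y := by linarith
  have hsq0 : 0 < Real.sqrt y := Real.sqrt_pos.2 hy0
  set θ := hexConnectiveConstant ^ 2 / Real.sqrt y with hθ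
  set C := hexConnectiveConstant ^ 2 * Real.sqrt y with hC
  have hθ0 : 0 < θ := theta_pos_wren hy0
  have hθ1 : θ < 1 := theta_lt_one_wren hy
  have hCθ : C * θ = hexConnectiveConstant ^ 4 := by
    rw [hC, hθ]; field_simp
  have hterm : ∀ k : ℕ, (k : ℝ) * pwbLaw y k ≤ pwbLaw y k + ((k - 1 : ℕ) : ℝ) * (C * θ ^ k) := by
    intro k
    rcases Nat.eq_zero_or_pos k with h | h
    · subst h; simp [pwbLaw_zero]
    · have hk : (k : ℝ) = 1 + ((k - 1 : ℕ) : ℝ) := by rw [Nat.cast_sub h, Nat.cast_one]; ring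
      rw [hk, add_mul, one_mul]
      exact add_le_add le_rfl (mul_le_mul_of_nonneg_left (pwbLaw_le_geom hy1 k) (Nat.cast_nonneg _))
  have hθn : ‖θ‖ < 1 := by rw [Real.norm_eq_abs, abs_of_pos hθ0]; exact hθ1
  have h0 := (hasSum_coe_mul_geometric_of_norm_lt_one hθn).mul_left (C * θ)
  have h1 : HasSum (fun n : ℕ => (((n + 1 - 1 : ℕ) : ℝ)) * (C * θ ^ (n + 1))) (C * θ * (θ / (1 - θ) ^ 2)) := by
    have he : (fun n : ℕ => (((n + 1 - 1 : ℕ) : ℝ)) * (C * θ ^ (n + 1))) = fun i : ℕ => C * θ * ((i : ℝ) * θ ^ i) := by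
      funext n
      simp only [Nat.add_sub_cancel, pow_succ]
      ring
    rw [he]; exact h0
  have hF := (hasSum_nat_add_iff (f := fun k : ℕ => ((k - 1 : ℕ) : ℝ) * (C * θ ^ k)) 1).1 h1
  simp only [Finset.sum_range_one, Nat.zero_sub, Nat.cast_zero, zero_mul, add_zero] at hF
  have hsum := hasSum_le hterm (summable_mul_pwbLaw hy).hasSum ((hasSum_pwbLaw hy).add hF)
  calc pwbMean y ≤ 1 + C * θ * (θ / (1 - θ) ^ 2) := hsum
    _ = _ := by rw [hCθ]

end Literature.Probability.RandomPlanarGeometry.SAW.HexBW.Wall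

end
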